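import Literature.Probability.Percolation.FiveMarkedLoopSpace
import HarnessLib

/-!
# The five-point normalisation on every five-marked discrete domain

Topic `Literature/Probability/Percolation`; lane pcv-sawmu (CriticalPhenomena), door (v) «five-point observables on the
honeycomb», statement (N) of the lane's interface layer (`FiveMarkedLoops.lean`, Part 1): for every `D : TriMarkedDomain 5`,
every colour `c` and every inner edge `{x, x'}` of `H_G` (`x` an interior face, `{x, x'}` dual to a bond of `G`),
`Σ_{r : Fin 5} midEdgeProb D r c x x' = 1` — the five mid-edge probabilities under the five reference boundary conditions sum
to one (`hexFivePointNormalisation_holds`, spelled out; per domain `fivePointNormalisationD_holds`).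

Proof (pcv-sawmu b-engine-2 g5 with a-p4 g6 and b-step0 g9; Khristoforov–Smirnov 2021 §1.2's loop representation with SIX
disorders — the five corner faces and the mid-point of the inner edge — on top of the loop lemma and the `2 ^ #G` count of
`FiveMarkedLoopSpace.lean`):
* the SIX-ODD-POINT SPACE `loopSpace6 D u v s` (edge sets of `H_G` avoiding the bond `s(u, v)` whose odd faces are the five
  corners and `s ∈ {x, x'}`) and the classes `InClass` (`W_{j,M}(s)`: the path from `s` ends at the corner `y_j`, the other
  four corners pair as `A_j` or `B_j`);
* N1 `sixCount_holds`: `#T6(x) + #T6(x') = 2 ^ #G` (`card_filter_parity_eq` + the `s(u,v)`-split);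
* N2 `sixStructure_holds`: every element lies in exactly one class (side graph of maximum degree two: `odd_component`; removing
  the component of `s` leaves an element of `loopSpace D j`, whose pairing is `A_j` xor `B_j` by the loop lemma);
* N3 `sixTransport_holds`: `#W_{j,M}(x) + #W_{j,M}(x') = #{T ⊆ G : Match_M ∧ (x or x' joined to y_j off the interfaces)}` as the
  chain B1 (colourings ↔ loop configurations, `transportColour_holds`, a-p4 g6) ∘ B2 (erase the inner bond, `transportErase_of`)
  ∘ A (the INVOLUTION `A ↦ A ∆ γ(IP_j(A))` with one transport set chosen per interface vertex set — `transportCore_of`; no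
  connectedness of `γ` is needed) ∘ C (split by the odd endpoint, `transportSplit_holds`, b-step0 g9), with the three small
  faces `xorDeg_holds`, `reachXor_holds`, `chainEdgeSet_holds` (b-step0 g9);
* N4 `fivePointNormalisation_of_faces` (counting bridge `triSitePercolation_half_real_setOf_eq_card_div`, `MatchA` xor `MatchB`).

Status in print (lane label cell, lit-2): the mechanism is Khristoforov–Smirnov 2021 §1.2 (Lemma 2: colourings ↔ loop
configurations; Def. 3 / Lemma 4: transport of a disorder along a path); the five-disorder normalisation itself is the
lane's statement (D6′ pilot: exact on 3 888 honeycomb checks, false for the `ℤ²` bond analogue) — first proof text, for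
every finite five-marked domain.

## References
* M. Khristoforov, S. Smirnov, *Percolation and O(1) loop model*, arXiv:2111.15612 (2021), §1.2 (loop configurations, Def. 3, Lemma 2, Lemma 4).
* B. Bollobás, O. Riordan, *Percolation*, Cambridge University Press (2006), Ch. 7 §7.2.2 pp. 168–171 (Lemma 5, Fig. 9).
-/

open Finset

namespace Literature.Probability.Percolation.FivePoint

open Literature.Probability.Percolation Literature.Probability.LatticeModels

variable (D : TriMarkedDomain 5)

/-- Auxiliary. [folklore] -/
private theorem fin3_cases₅ (v j : Fin 3) : j = v ∨ j = v + 1 ∨ j = v + 2 := by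
  revert v j; decide

/-! # (N) FIVE-POINT NORMALISATION — the six-odd-point space, faces N1–N3, assembly (b-engine-2 g5)

The road from KhS21 Lemma 2 (above, all ∀ D) to (N) `Σ_r midEdgeProb D r c x x' = 1` (D1-v2; FIVEPOINT-PROOF.md §2–§4,
`gen5/DOOR-V-NEXT.md`). Objects: an inner `H_G`-edge `{x, x'}` dual to the bond `s(u, v)` (`u, v ∈ G`); the SIX-ODD-POINT SPACE
`loopSpace6 u v s` = edge sets of `H_G` AVOIDING `s(u,v)` whose odd faces are the five corner faces and the face `s ∈ {x, x'}`
(= KhS21's `W_Ω(u_0,…,u_4, m_ε)` on the subdivided edge, split by which half-edge at `m` is used). Faces: N1 count (PROVED below from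
`card_filter_parity_eq`), N2 structure (the `s`-path ends at exactly one corner `y_j`, the other four corners pair as `A_j` or `B_j`),
N3 transport (`#W_{j,M} = #{colourings : Match_M ∧ (x or x' joined to y_j)}`), N4 assembly. -/

namespace N5

open Classical in
/-- **the six-odd-point space**: edge sets of `H_G` avoiding the bond `s(u, v)` (dual to the inner edge `{x, x'}`) whose faces of
odd degree are exactly the five corner faces and the face `s`. [KhS21 §1.2: `W_Ω(U)` with `U` = five boundary disorders + one
interior disorder] [folklore] -/
noncomputable def loopSpace6 (u v : Site 2) (s : HexVertex) : Finset (Finset (Sym2 (Site 2))) :=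
  ((hBonds D).erase s(u, v)).powerset.filter fun ξ =>
    ∀ F ∈ triFacesTouching D.verts, (Odd (xiDeg ξ F) ↔ ((∃ j : Fin 5, IsCornerFace D j F) ∨ F = s))

/-- the class `W_{j,M}(s)`: the path from `s` ends at the corner `y_j`, and the corners `y_{j+1}`, `y_{j+2}` are linked (M = A,
`m = false`) resp. `y_{j+1}`, `y_{j+4}` (M = B, `m = true`). [cite: KhristoforovSmirnov2021, §1.2 (loop configurations, pp. 3–4)] -/
def InClass (u v : Site 2) (s : HexVertex) (j : Fin 5) (m : Bool) (ξ : Finset (Sym2 (Site 2))) : Prop :=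
  ξ ∈ loopSpace6 D u v s ∧ (∃ Y : HexVertex, IsCornerFace D j Y ∧ XiLinked ξ s Y) ∧
    (∃ Y₁ Y₂ : HexVertex, IsCornerFace D (j + 1) Y₁ ∧ IsCornerFace D (if m then j + 4 else j + 2) Y₂ ∧ XiLinked ξ Y₁ Y₂)

/-- **N1 (COUNT)**: `#T6(x) + #T6(x') = 2 ^ #G` — the six-odd-point space of the subdivided edge has `2^{#Faces}` elements. [cite: KhristoforovSmirnov2021, §1.2 (loop configurations, pp. 3–4)] -/
def SixCount (D : TriMarkedDomain 5) : Prop :=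
  ∀ (x x' : HexVertex) (u v : Site 2), hexFaceVertices x ⊆ D.verts → hexGraph.Adj x x' → faceEdge x x' = {u, v} →
    u ∈ D.verts → v ∈ D.verts →
      #(loopSpace6 D u v x) + #(loopSpace6 D u v x') = 2 ^ #D.verts

/-- **N2 (STRUCTURE)**: every element of `T6(s)` lies in exactly one class `W_{j,M}(s)` (max degree two: the component of `s` is a
path to a corner `y_j`; removing it leaves an element of `loopSpace D j`, whose pairing is `A_j` or `B_j` by the loop lemma). [cite: KhristoforovSmirnov2021, §1.2 (loop configurations, pp. 3–4)] -/
def SixStructure (D : TriMarkedDomain 5) : Prop :=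
  ∀ (x x' : HexVertex) (u v : Site 2), hexFaceVertices x ⊆ D.verts → hexGraph.Adj x x' → faceEdge x x' = {u, v} →
    u ∈ D.verts → v ∈ D.verts → ∀ s ∈ ({x, x'} : Finset HexVertex), ∀ ξ ∈ loopSpace6 D u v s,
      ∃! p : Fin 5 × Bool, InClass D u v s p.1 p.2 ξ

open Classical in
/-- **N3 (TRANSPORT, K5′)**: `#W_{j,A}(x) + #W_{j,A}(x') = #{T ⊆ G : MatchA ∧ (x or x' joined to y_j)}` and likewise for `B` —
XOR with a path from `y_j` to the mid-edge inside the component of `y_j` off the interfaces (FIVEPOINT-PROOF §3). [cite: KhristoforovSmirnov2021, §1.2 (loop configurations, pp. 3–4)] -/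
def SixTransport (D : TriMarkedDomain 5) : Prop :=
  ∀ (x x' : HexVertex) (u v : Site 2), hexFaceVertices x ⊆ D.verts → hexGraph.Adj x x' → faceEdge x x' = {u, v} →
    u ∈ D.verts → v ∈ D.verts → ∀ (c : Bool) (j : Fin 5) (m : Bool),
      #((loopSpace6 D u v x).filter fun ξ => InClass D u v x j m ξ) +
          #((loopSpace6 D u v x').filter fun ξ => InClass D u v x' j m ξ) =
        #(D.verts.powerset.filter fun T : Finset (Site 2) =>
          (if m then MatchB D (↑T : Set (Site 2)) j c else MatchA D (↑T : Set (Site 2)) j c) ∧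
            (Joined D (↑T : Set (Site 2)) j c x ∨ Joined D (↑T : Set (Site 2)) j c x'))

/-- **(N) per domain**: the five mid-edge probabilities of an inner edge sum to one (the lane's statement (N) at `D`). [cite: KhristoforovSmirnov2021, §1.2 (loop configurations, pp. 3–4)] -/
def FivePointNormalisationD (D : TriMarkedDomain 5) : Prop :=
  ∀ (c : Bool) (x x' : HexVertex), hexFaceVertices x ⊆ D.verts → hexGraph.Adj x x' → faceEdge x x' ⊆ D.verts →
    ∑ r : Fin 5, midEdgeProb D r c x x' = 1

/-! ### The assembly (N4): the three faces give (N) — real proof (T5-style consistency of the face list) -/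

/-- for adjacent faces the shared side has two (distinct) endpoints. [cite: KhristoforovSmirnov2021, §1.2 (loop configurations, pp. 3–4)] -/
theorem exists_faceEdge_eq_pair {x x' : HexVertex} (h : hexGraph.Adj x x') :
    ∃ u v : Site 2, u ≠ v ∧ faceEdge x x' = {u, v} := by
  have h2 : #(faceEdge x x') = 2 := ((hexGraph_adj_iff x x').1 h).2
  obtain ⟨u, v, huv, he⟩ := Finset.card_eq_two.1 h2
  exact ⟨u, v, huv, he⟩

open Classical in
/-- the mid-edge probability as a count (tree counting bridge + locality of `Joined`). [cite: KhristoforovSmirnov2021, §1.2 (loop configurations, pp. 3–4)] -/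
theorem midEdgeProb_eq_card_div (r : Fin 5) (c : Bool) (x x' : HexVertex) :
    midEdgeProb D r c x x' =
      (#(D.verts.powerset.filter fun T : Finset (Site 2) =>
          Joined D (↑T : Set (Site 2)) r c x ∨ Joined D (↑T : Set (Site 2)) r c x') : ℝ) / 2 ^ #D.verts := by
  unfold midEdgeProb midEdgeEvent
  convert triSitePercolation_half_real_setOf_eq_card_div (P := fun σ => Joined D σ r c x ∨ Joined D σ r c x') D.verts
    fun σ => by rw [joined_inter_iff, joined_inter_iff] using 4
  exact (Finset.filter_congr_decidable _ _ _).symm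

open Classical in
/-- splitting the joined colourings by their matching (exactly one of A, B by the loop lemma). [cite: KhristoforovSmirnov2021, §1.2 (loop configurations, pp. 3–4)] -/
theorem card_joined_split (r : Fin 5) (c : Bool) (x x' : HexVertex) :
    #(D.verts.powerset.filter fun T : Finset (Site 2) =>
        Joined D (↑T : Set (Site 2)) r c x ∨ Joined D (↑T : Set (Site 2)) r c x') =
      #(D.verts.powerset.filter fun T : Finset (Site 2) =>
          MatchA D (↑T : Set (Site 2)) r c ∧ (Joined D (↑T : Set (Site 2)) r c x ∨ Joined D (↑T : Set (Site 2)) r c x')) +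
      #(D.verts.powerset.filter fun T : Finset (Site 2) =>
          MatchB D (↑T : Set (Site 2)) r c ∧ (Joined D (↑T : Set (Site 2)) r c x ∨ Joined D (↑T : Set (Site 2)) r c x')) := by
  have hxor : ∀ T : Finset (Site 2), Xor (MatchA D (↑T : Set (Site 2)) r c) (MatchB D (↑T : Set (Site 2)) r c) := by
    intro T
    cases c
    · exact (fiveMarkedLoopLemma_holds D ↑T r).1
    · exact (fiveMarkedLoopLemma'_holds D ↑T r).1
  rw [← Finset.card_filter_add_card_filter_not (fun T : Finset (Site 2) => MatchA D (↑T : Set (Site 2)) r c)]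
  rw [Finset.filter_filter, Finset.filter_filter]
  congr 1
  · congr 1
    exact Finset.filter_congr fun T _ => by rw [and_comm]
  · congr 1
    refine Finset.filter_congr fun T _ => ?_
    have hx := hxor T
    constructor
    · rintro ⟨hJ, hnA⟩
      exact ⟨(hx.or.resolve_left hnA), hJ⟩
    · rintro ⟨hB, hJ⟩
      refine ⟨hJ, fun hA => ?_⟩
      rcases hx with ⟨-, hnB⟩ | ⟨-, hnA⟩
      · exact hnB hB
      · exact hnA hA

open Classical in
/-- a set partitioned by `∃!`-classes: its cardinality is the sum of the class cardinalities. [folklore] -/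
private theorem card_eq_sum_card_classes {α β : Type*} [Fintype β] (S : Finset α) (P : β → α → Prop)
    (h : ∀ a ∈ S, ∃! b : β, P b a) : #S = ∑ b, #(S.filter fun a => P b a) := by
  simp only [Finset.card_filter]
  rw [Finset.sum_comm]
  rw [Finset.card_eq_sum_ones]
  refine Finset.sum_congr rfl fun a ha => ?_
  obtain ⟨b, hb, huniq⟩ := h a ha
  rw [Finset.sum_ite, Finset.sum_const_zero, add_zero, Finset.sum_const, smul_eq_mul, mul_one]
  have : (Finset.univ.filter fun b' : β => P b' a) = {b} := by
    ext b'
    simp only [Finset.mem_filter, Finset.mem_univ, true_and, Finset.mem_singleton]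
    exact ⟨fun h' => huniq b' h', fun h' => h' ▸ hb⟩
  rw [this, Finset.card_singleton]

/-- **N4: the faces N1 (count), N2 (structure), N3 (transport) imply (N) on `D`** — real proof. [cite: KhristoforovSmirnov2021, §1.2 (loop configurations, pp. 3–4)] -/
theorem fivePointNormalisation_of_faces (h1 : SixCount D) (h2 : SixStructure D) (h3 : SixTransport D) :
    FivePointNormalisationD D := by
  classical
  intro c x x' hx hadj hε
  obtain ⟨u, v, huv, he⟩ := exists_faceEdge_eq_pair hadj
  have hu : u ∈ D.verts := hε (by rw [he]; simp)
  have hv : v ∈ D.verts := hε (by rw [he]; simp)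
  -- probabilities as counts
  simp only [midEdgeProb_eq_card_div, card_joined_split]
  rw [← Finset.sum_div]
  rw [div_eq_one_iff_eq (by positivity)]
  -- the counts, via N3, are class sizes in the two six-odd-point spaces
  have hcount : ∀ r : Fin 5,
      (#(D.verts.powerset.filter fun T : Finset (Site 2) =>
          MatchA D (↑T : Set (Site 2)) r c ∧ (Joined D (↑T : Set (Site 2)) r c x ∨ Joined D (↑T : Set (Site 2)) r c x')) : ℝ) +
        #(D.verts.powerset.filter fun T : Finset (Site 2) =>
          MatchB D (↑T : Set (Site 2)) r c ∧ (Joined D (↑T : Set (Site 2)) r c x ∨ Joined D (↑T : Set (Site 2)) r c x')) =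
      ∑ m : Bool, ((#((loopSpace6 D u v x).filter fun ξ => InClass D u v x r m ξ) : ℝ) +
        #((loopSpace6 D u v x').filter fun ξ => InClass D u v x' r m ξ)) := by
    intro r
    rw [Fintype.sum_bool]
    have hA := h3 x x' u v hx hadj he hu hv c r false
    have hB := h3 x x' u v hx hadj he hu hv c r true
    simp only [Bool.false_eq_true, ↓reduceIte] at hA hB
    rw [← hA, ← hB]
    push_cast
    ring
  push_cast
  simp only [hcount]
  -- regroup: Σ_r Σ_m (W(x) + W(x')) = #T6(x) + #T6(x')
  have hpart : ∀ s ∈ ({x, x'} : Finset HexVertex),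
      (∑ r : Fin 5, ∑ m : Bool, (#((loopSpace6 D u v s).filter fun ξ => InClass D u v s r m ξ) : ℝ)) = #(loopSpace6 D u v s) := by
    intro s hs
    have := card_eq_sum_card_classes (loopSpace6 D u v s) (fun p : Fin 5 × Bool => InClass D u v s p.1 p.2)
      (fun ξ hξ => h2 x x' u v hx hadj he hu hv s hs ξ hξ)
    rw [this, Fintype.sum_prod_type]
    push_cast
    rfl
  have hx_mem : x ∈ ({x, x'} : Finset HexVertex) := by simp
  have hx'_mem : x' ∈ ({x, x'} : Finset HexVertex) := by simp
  simp only [Finset.sum_add_distrib]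
  rw [hpart x hx_mem, hpart x' hx'_mem]
  have := h1 x x' u v hx hadj he hu hv
  exact_mod_cast this

/-! ### N1 proved: `SixCount D` (the b₀-split of the six-odd-point pattern {corners} ∪ {x} on `H_G`) -/

/-- every mark has a corner face: the face left of the predecessor dart. [cite: KhristoforovSmirnov2021, §1.2 (loop configurations, pp. 3–4)] -/
theorem cornerFace_exists (j : Fin 5) : ∃ Y : HexVertex, IsCornerFace D j Y := by
  have hpd := predDart_mem D j
  obtain ⟨hm, ho', hadj⟩ := mem_triBdryDarts.1 hpd
  have hsucc := succ_predDart D j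
  -- the successor keeps the tail, so the apex is outside and is the head of the marked dart
  have hapex : triLeftApex (predDart D j).1 (predDart D j).2 ∉ D.verts := by
    intro hin
    have h1 : (triBdrySucc D.verts (predDart D j)).1 = triLeftApex (predDart D j).1 (predDart D j).2 := by
      rw [triBdrySucc, if_pos hin]
    rw [hsucc] at h1
    have h2 : (D.markDart j).1 = (predDart D j).1 := (predDart_fst D j).symm
    exact (triLeftApex_ne hadj).1 (h1.symm.trans h2)
  have hmark : D.markDart j = ((predDart D j).1, triLeftApex (predDart D j).1 (predDart D j).2) := by
    rw [← hsucc, triBdrySucc, if_neg hapex]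
  refine ⟨leftFace (predDart D j).1 (predDart D j).2, ?_⟩
  unfold IsCornerFace
  rw [hexFaceVertices_leftFace hadj, ← predDart_fst D j, hmark]
  simp only [Finset.pair_comm]

/-- removing a bond that is not a side of `F` does not change the side count of `F`. [cite: KhristoforovSmirnov2021, §1.2 (loop configurations, pp. 3–4)] -/
theorem xiDeg_erase_of_forall_ne {ξ : Finset (Sym2 (Site 2))} {b : Sym2 (Site 2)} {F : HexVertex} (h : ∀ j : Fin 3, side F j ≠ b) :
    xiDeg (ξ.erase b) F = xiDeg ξ F := by
  classical
  unfold xiDeg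
  congr 1
  refine Finset.filter_congr fun j _ => ?_
  rw [Finset.mem_erase]
  exact ⟨fun h' => h'.2, fun h' => ⟨h j, h'⟩⟩

/-- removing a side of `F` that belongs to `ξ` lowers the side count of `F` by one. [cite: KhristoforovSmirnov2021, §1.2 (loop configurations, pp. 3–4)] -/
theorem xiDeg_erase_side {ξ : Finset (Sym2 (Site 2))} {F : HexVertex} {j₀ : Fin 3} (hb : side F j₀ ∈ ξ) :
    xiDeg (ξ.erase (side F j₀)) F + 1 = xiDeg ξ F := by
  classical
  unfold xiDeg
  have hsplit := Finset.card_filter_add_card_filter_not (s := (Finset.univ : Finset (Fin 3)).filter fun j => side F j ∈ ξ)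
    (fun j => j ≠ j₀)
  rw [Finset.filter_filter, Finset.filter_filter] at hsplit
  have h1 : ((Finset.univ : Finset (Fin 3)).filter fun j => side F j ∈ ξ ∧ j ≠ j₀) =
      (Finset.univ : Finset (Fin 3)).filter fun j => s(faceVertex F (j + 1), faceVertex F (j + 2)) ∈ ξ.erase (side F j₀) := by
    refine Finset.filter_congr fun j _ => ?_
    rw [Finset.mem_erase]
    constructor
    · rintro ⟨h, hne⟩; exact ⟨fun e => hne (side_injective F e), h⟩
    · rintro ⟨hne, h⟩; exact ⟨h, fun e => hne (by rw [e]; rfl)⟩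
  have h2 : ((Finset.univ : Finset (Fin 3)).filter fun j => side F j ∈ ξ ∧ ¬ j ≠ j₀) = {j₀} := by
    ext j
    simp only [Finset.mem_filter, Finset.mem_univ, true_and, not_not, Finset.mem_singleton]
    exact ⟨fun h => h.2, fun h => ⟨h ▸ hb, h⟩⟩
  rw [h1, h2, Finset.card_singleton] at hsplit
  exact hsplit

/-- the touching faces incident to the inner bond `s(u, v)` are the two faces `x`, `x'` sharing it. [cite: KhristoforovSmirnov2021, §1.2 (loop configurations, pp. 3–4)] -/
theorem eq_or_eq_of_inc {x x' : HexVertex} {u v : Site 2} (hadj : hexGraph.Adj x x') (he : faceEdge x x' = {u, v})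
    (hu : u ∈ D.verts) {F : HexVertex} (hF : F ∈ triFacesTouching D.verts) (hinc : Inc F s(u, v)) : F = x ∨ F = x' := by
  classical
  have huv : triGraph.Adj u v := by
    have hux : u ∈ hexFaceVertices x := Finset.mem_of_mem_inter_left (by rw [show hexFaceVertices x ∩ hexFaceVertices x' = faceEdge x x' from rfl, he]; simp)
    have hvx : v ∈ hexFaceVertices x := Finset.mem_of_mem_inter_left (by rw [show hexFaceVertices x ∩ hexFaceVertices x' = faceEdge x x' from rfl, he]; simp)
    have hne : u ≠ v := by
      intro e
      have : #(faceEdge x x') = 2 := ((hexGraph_adj_iff x x').1 hadj).2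
      rw [he, e] at this
      simp at this
    exact adj_of_mem_hexFaceVertices hux hvx hne
  have hpair := filter_inc_eq_pair D hu huv
  have hmem : ∀ F', F' ∈ triFacesTouching D.verts → Inc F' s(u, v) → F' = leftFace u v ∨ F' = leftFace v u := by
    intro F' hF' hinc'
    have : F' ∈ (triFacesTouching D.verts).filter (fun F => Inc F s(u, v)) := Finset.mem_filter.2 ⟨hF', hinc'⟩
    rw [hpair, Finset.mem_insert, Finset.mem_singleton] at this
    exact this
  have hxinc : Inc x s(u, v) := inc_mk_iff.2 ⟨Finset.mem_of_mem_inter_left (s₂ := hexFaceVertices x') (by rw [show hexFaceVertices x ∩ hexFaceVertices x' = faceEdge x x' from rfl, he]; simp),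
    Finset.mem_of_mem_inter_left (s₂ := hexFaceVertices x') (by rw [show hexFaceVertices x ∩ hexFaceVertices x' = faceEdge x x' from rfl, he]; simp)⟩
  have hx'inc : Inc x' s(u, v) := inc_mk_iff.2 ⟨Finset.mem_of_mem_inter_right (s₁ := hexFaceVertices x) (by rw [show hexFaceVertices x ∩ hexFaceVertices x' = faceEdge x x' from rfl, he]; simp),
    Finset.mem_of_mem_inter_right (s₁ := hexFaceVertices x) (by rw [show hexFaceVertices x ∩ hexFaceVertices x' = faceEdge x x' from rfl, he]; simp)⟩
  have hxT : x ∈ triFacesTouching D.verts := mem_triFacesTouching.2 ⟨u, hu, (inc_mk_iff.1 hxinc).1⟩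
  have hx'T : x' ∈ triFacesTouching D.verts := mem_triFacesTouching.2 ⟨u, hu, (inc_mk_iff.1 hx'inc).1⟩
  have hxx' : x ≠ x' := hadj.ne
  rcases hmem x hxT hxinc with ex | ex <;> rcases hmem x' hx'T hx'inc with ex' | ex' <;> rcases hmem F hF hinc with eF | eF
  · exact absurd (ex.trans ex'.symm) hxx'
  · exact absurd (ex.trans ex'.symm) hxx'
  · exact Or.inl (eF.trans ex.symm)
  · exact Or.inr (eF.trans ex'.symm)
  · exact Or.inr (eF.trans ex'.symm)
  · exact Or.inl (eF.trans ex.symm)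
  · exact absurd (ex.trans ex'.symm) hxx'
  · exact absurd (ex.trans ex'.symm) hxx'

/-- **N1 holds for every domain**: `#T6(x) + #T6(x') = 2 ^ #G`. [cite: KhristoforovSmirnov2021, §1.2 (loop configurations, pp. 3–4)] -/
theorem sixCount_holds : SixCount D := by
  classical
  intro x x' u v hx hadj he hu hv
  -- the corner faces
  choose Y hY using cornerFace_exists D
  have hYinj : Function.Injective Y := fun i j h => cornerFace_idx_unique D (hY i) (h ▸ hY j)
  -- x is not a corner face, and touches G
  have hx_not_corner : ∀ j, ¬ IsCornerFace D j x := by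
    intro j hc
    obtain ⟨w, hw, hw1, hw2, -⟩ := isCornerFace_typeII D hc
    exact hw1 (hx (faceVertex_mem _ _))
  have hxT : x ∈ triFacesTouching D.verts := mem_triFacesTouching.2 ⟨_, hx (faceVertex_mem x 0), faceVertex_mem x 0⟩
  -- the odd set O = {Y 0, …, Y 4, x}
  set O : Finset HexVertex := insert x (Finset.univ.image Y) with hO
  have hOsub : O ⊆ triFacesTouching D.verts := by
    intro F hF
    rw [hO, Finset.mem_insert, Finset.mem_image] at hF
    rcases hF with rfl | ⟨j, -, rfl⟩
    · exact hxT
    · exact cornerFace_mem_touching D (hY j)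
  have hOcard : #O = 6 := by
    rw [hO, Finset.card_insert_of_notMem, Finset.card_image_of_injective _ hYinj, Finset.card_univ, Fintype.card_fin]
    rw [Finset.mem_image]
    rintro ⟨j, -, hj⟩
    exact hx_not_corner j (hj ▸ hY j)
  have hmemO : ∀ F, F ∈ O ↔ ((∃ j : Fin 5, IsCornerFace D j F) ∨ F = x) := by
    intro F
    rw [hO, Finset.mem_insert, Finset.mem_image]
    constructor
    · rintro (rfl | ⟨j, -, rfl⟩)
      · exact Or.inr rfl
      · exact Or.inl ⟨j, hY j⟩
    · rintro (⟨j, hj⟩ | rfl)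
      · exact Or.inr ⟨j, Finset.mem_univ _, cornerFace_unique D (hY j) hj⟩
      · exact Or.inl rfl
  have hcount := card_filter_parity_eq D hOsub (by rw [hOcard]; decide)
  -- s(u, v) and its two faces
  have huv : triGraph.Adj u v := by
    have hux : u ∈ hexFaceVertices x := Finset.mem_of_mem_inter_left (s₂ := hexFaceVertices x')
      (by rw [show hexFaceVertices x ∩ hexFaceVertices x' = faceEdge x x' from rfl, he]; simp)
    have hvx : v ∈ hexFaceVertices x := Finset.mem_of_mem_inter_left (s₂ := hexFaceVertices x')
      (by rw [show hexFaceVertices x ∩ hexFaceVertices x' = faceEdge x x' from rfl, he]; simp)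
    have hne : u ≠ v := by
      intro e
      have : #(faceEdge x x') = 2 := ((hexGraph_adj_iff x x').1 hadj).2
      rw [he, e] at this
      simp at this
    exact adj_of_mem_hexFaceVertices hux hvx hne
  have hbB : s(u, v) ∈ hBonds D := mem_hBonds D huv (Or.inl hu)
  -- which faces have s(u, v) as a side
  have hside_iff : ∀ F ∈ triFacesTouching D.verts, (∃ j : Fin 3, side F j = s(u, v)) ↔ (F = x ∨ F = x') := by
    intro F hF
    constructor
    · rintro ⟨j, hj⟩
      exact eq_or_eq_of_inc D hadj he hu hF (by rw [← hj]; exact inc_side F j)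
    · intro hF'
      have hinc : Inc F s(u, v) := by
        rcases hF' with rfl | rfl
        · exact inc_mk_iff.2 ⟨Finset.mem_of_mem_inter_left (s₂ := hexFaceVertices x')
            (by rw [show hexFaceVertices F ∩ hexFaceVertices x' = faceEdge F x' from rfl, he]; simp),
            Finset.mem_of_mem_inter_left (s₂ := hexFaceVertices x')
            (by rw [show hexFaceVertices F ∩ hexFaceVertices x' = faceEdge F x' from rfl, he]; simp)⟩
        · exact inc_mk_iff.2 ⟨Finset.mem_of_mem_inter_right (s₁ := hexFaceVertices x)
            (by rw [show hexFaceVertices x ∩ hexFaceVertices F = faceEdge x F from rfl, he]; simp),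
            Finset.mem_of_mem_inter_right (s₁ := hexFaceVertices x)
            (by rw [show hexFaceVertices x ∩ hexFaceVertices F = faceEdge x F from rfl, he]; simp)⟩
      obtain ⟨j, hj⟩ := exists_side_eq_of_inc D hbB hinc
      exact ⟨j, hj.symm⟩
  have hxx' : x ≠ x' := hadj.ne
  have hx'T : x' ∈ triFacesTouching D.verts := mem_triFacesTouching.2 ⟨u, hu, Finset.mem_of_mem_inter_right (s₁ := hexFaceVertices x)
      (by rw [show hexFaceVertices x ∩ hexFaceVertices x' = faceEdge x x' from rfl, he]; simp)⟩
  have hx'_not_corner : ∀ j, ¬ IsCornerFace D j x' := by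
    intro j hc
    obtain ⟨w, hw, hw1, hw2, -⟩ := isCornerFace_typeII D hc
    -- x' has the two G-vertices u, v: at most one of its vertices is outside... but a corner face has two outside
    have hux' : u ∈ hexFaceVertices x' := Finset.mem_of_mem_inter_right (s₁ := hexFaceVertices x)
      (by rw [show hexFaceVertices x ∩ hexFaceVertices x' = faceEdge x x' from rfl, he]; simp)
    have hvx' : v ∈ hexFaceVertices x' := Finset.mem_of_mem_inter_right (s₁ := hexFaceVertices x)
      (by rw [show hexFaceVertices x ∩ hexFaceVertices x' = faceEdge x x' from rfl, he]; simp)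
    have key : ∀ z ∈ hexFaceVertices x', z ∈ D.verts → z = faceVertex x' w := by
      intro z hz hzG
      obtain ⟨i, rfl⟩ := mem_hexFaceVertices_iff_faceVertex.1 hz
      rcases fin3_cases₅ w i with e | e | e
      · rw [e]
      · exact absurd (e ▸ hzG) hw1
      · exact absurd (e ▸ hzG) hw2
    have hne : u ≠ v := huv.ne
    exact hne ((key u hux' hu).trans (key v hvx' hv).symm)
  -- the split of S = {ξ ⊆ hBonds : odd(ξ) = O} by s(u, v) ∈ ξ
  set S := (hBonds D).powerset.filter fun ξ => ∀ F ∈ triFacesTouching D.verts, (Odd (xiDeg ξ F) ↔ F ∈ O) with hS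
  have hS0 : S.filter (fun ξ => s(u, v) ∉ ξ) = loopSpace6 D u v x := by
    ext ξ
    unfold loopSpace6
    rw [Finset.mem_filter, hS, Finset.mem_filter, Finset.mem_powerset, Finset.mem_filter, Finset.mem_powerset]
    constructor
    · rintro ⟨⟨hsub, hpar⟩, hb⟩
      refine ⟨fun e he' => Finset.mem_erase.2 ⟨fun h => hb (by rw [← h]; exact he'), hsub he'⟩, fun F hF => ?_⟩
      rw [hpar F hF, hmemO]
    · rintro ⟨hsub, hpar⟩
      refine ⟨⟨fun e he' => (Finset.mem_erase.1 (hsub he')).2, fun F hF => ?_⟩, fun hb => (Finset.mem_erase.1 (hsub hb)).1 rfl⟩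
      rw [hpar F hF, hmemO]
  have hS1 : #(S.filter (fun ξ => s(u, v) ∈ ξ)) = #(loopSpace6 D u v x') := by
    refine Finset.card_bij (fun ξ _ => ξ.erase s(u, v)) (fun ξ hξ => ?_) (fun ξ hξ ξ' hξ' h => ?_) (fun ζ hζ => ?_)
    · obtain ⟨hξS, hb⟩ := Finset.mem_filter.1 hξ
      rw [hS, Finset.mem_filter, Finset.mem_powerset] at hξS
      obtain ⟨hsub, hpar⟩ := hξS
      unfold loopSpace6
      refine Finset.mem_filter.2 ⟨Finset.mem_powerset.2 (Finset.erase_subset_erase _ hsub), fun F hF => ?_⟩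
      by_cases hFx : F = x ∨ F = x'
      · obtain ⟨j₀, hj₀⟩ := (hside_iff F hF).2 hFx
        have hdeg := xiDeg_erase_side (ξ := ξ) (F := F) (j₀ := j₀) (hj₀ ▸ hb)
        rw [hj₀] at hdeg
        have hparF := hpar F hF
        rw [hmemO] at hparF
        have hflip : Odd (xiDeg (ξ.erase s(u, v)) F) ↔ ¬ Odd (xiDeg ξ F) := by
          rw [← hdeg, Nat.odd_add_one, not_not]
        rw [hflip, hparF]
        rcases hFx with rfl | rfl
        · -- F = x: was odd, becomes even
          constructor
          · intro h; exact absurd (Or.inr rfl) h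
          · rintro (⟨j, hj⟩ | h)
            · exact absurd hj (hx_not_corner j)
            · exact absurd h hxx'
        · -- F = x': was even, becomes odd
          constructor
          · intro _; exact Or.inr rfl
          · rintro - (⟨j, hj⟩ | h')
            · exact hx'_not_corner j hj
            · exact hxx' h'.symm
      · push Not at hFx
        have hne : ∀ j : Fin 3, side F j ≠ s(u, v) := fun j hj => by
          rcases (hside_iff F hF).1 ⟨j, hj⟩ with h | h
          · exact hFx.1 h
          · exact hFx.2 h
        rw [xiDeg_erase_of_forall_ne hne, hpar F hF, hmemO]
        constructor
        · rintro (h | h)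
          · exact Or.inl h
          · exact absurd h hFx.1
        · rintro (h | h)
          · exact Or.inl h
          · exact absurd h hFx.2
    · have hb1 : s(u, v) ∈ ξ := (Finset.mem_filter.1 hξ).2
      have hb2 : s(u, v) ∈ ξ' := (Finset.mem_filter.1 hξ').2
      rw [← Finset.insert_erase hb1, ← Finset.insert_erase hb2, h]
    · -- surjective: ζ ↦ insert s(u, v) ζ
      unfold loopSpace6 at hζ
      obtain ⟨hsub, hpar⟩ := Finset.mem_filter.1 hζ
      have hsub' := Finset.mem_powerset.1 hsub
      have hb_not : s(u, v) ∉ ζ := fun h => (Finset.mem_erase.1 (hsub' h)).1 rfl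
      refine ⟨insert s(u, v) ζ, Finset.mem_filter.2 ⟨?_, Finset.mem_insert_self _ _⟩, Finset.erase_insert hb_not⟩
      rw [hS, Finset.mem_filter, Finset.mem_powerset]
      refine ⟨Finset.insert_subset hbB fun e he' => (Finset.mem_erase.1 (hsub' he')).2, fun F hF => ?_⟩
      have hz : xiDeg ζ F = xiDeg ((insert s(u, v) ζ).erase s(u, v)) F := by rw [Finset.erase_insert hb_not]
      by_cases hFx : F = x ∨ F = x'
      · obtain ⟨j₀, hj₀⟩ := (hside_iff F hF).2 hFx
        have hdeg := xiDeg_erase_side (ξ := insert s(u, v) ζ) (F := F) (j₀ := j₀) (hj₀ ▸ Finset.mem_insert_self _ _)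
        rw [hj₀, Finset.erase_insert hb_not] at hdeg
        have hparF := hpar F hF
        rw [hmemO]
        have hflip : Odd (xiDeg (insert s(u, v) ζ) F) ↔ ¬ Odd (xiDeg ζ F) := by
          rw [← hdeg, Nat.odd_add_one]
        rw [hflip, hparF]
        rcases hFx with rfl | rfl
        · -- F = x: even in ζ, odd after insert
          constructor
          · intro _; exact Or.inr rfl
          · rintro - (⟨j, hj⟩ | h')
            · exact hx_not_corner j hj
            · exact hxx' h'
        · -- F = x': odd in ζ, even after insert
          constructor
          · intro h; exact absurd (Or.inr rfl) h
          · rintro (⟨j, hj⟩ | h)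
            · exact absurd hj (hx'_not_corner j)
            · exact absurd h.symm hxx'
      · push Not at hFx
        have hne : ∀ j : Fin 3, side F j ≠ s(u, v) := fun j hj => by
          rcases (hside_iff F hF).1 ⟨j, hj⟩ with h | h
          · exact hFx.1 h
          · exact hFx.2 h
        have : xiDeg (insert s(u, v) ζ) F = xiDeg ζ F := by
          rw [hz]; exact (xiDeg_erase_of_forall_ne hne).symm
        rw [this, hpar F hF, hmemO]
        constructor
        · rintro (h | h)
          · exact Or.inl h
          · exact absurd h hFx.2
        · rintro (h | h)
          · exact Or.inl h
          · exact absurd h hFx.1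
  rw [← hS0, ← hS1, add_comm, Finset.card_filter_add_card_filter_not]
  exact hcount

/-! ### N2 pieces: the side graph of an abstract edge set, its degrees, and the component of `s` -/

/-- the side of the opposite face across which `F` is seen is the same bond. [cite: KhristoforovSmirnov2021, §1.2 (loop configurations, pp. 3–4)] -/
theorem side_oppFace_oppIdx (F : HexVertex) (j : Fin 3) : side (oppFace F j) (oppIdx F j) = side F j := by
  unfold side
  rw [faceVertex_oppFace_succ, faceVertex_oppFace_succ_succ, Sym2.eq_swap]

/-- **the side graph of an edge set `ξ`**: faces adjacent across a side lying in `ξ` (its reachability is `XiLinked ξ`). [folklore] -/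
def sideGraph (ξ : Finset (Sym2 (Site 2))) : SimpleGraph HexVertex where
  Adj F F' := ∃ j : Fin 3, F' = oppFace F j ∧ side F j ∈ ξ
  symm := ⟨fun F F' h => by
    obtain ⟨j, hF', hj⟩ := h
    refine ⟨oppIdx F j, ?_, ?_⟩
    · rw [hF', oppFace_oppFace]
    · rw [hF', side_oppFace_oppIdx]; exact hj⟩
  loopless := ⟨fun F h => by
    obtain ⟨j, hF, -⟩ := h
    exact (hexGraph_adj_oppFace F j).ne hF⟩

/-- Auxiliary. [cite: KhristoforovSmirnov2021, §1.2 (loop configurations, pp. 3–4)] -/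
theorem xiLinked_iff_reachable (ξ : Finset (Sym2 (Site 2))) (Y Y' : HexVertex) :
    XiLinked ξ Y Y' ↔ (sideGraph ξ).Reachable Y Y' := by
  rw [SimpleGraph.reachable_iff_reflTransGen]
  rfl

/-- a face with a side in `hBonds` touches `G`. [cite: KhristoforovSmirnov2021, §1.2 (loop configurations, pp. 3–4)] -/
theorem mem_touching_of_side_mem {F : HexVertex} {j : Fin 3} (h : side F j ∈ hBonds D) : F ∈ triFacesTouching D.verts := by
  obtain ⟨a, b, he, ha, -⟩ := exists_rep_of_mem_hBonds D h
  have : a ∈ hexFaceVertices F := by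
    have hinc := inc_side F j
    rw [he] at hinc
    exact (inc_mk_iff.1 hinc).1
  exact mem_triFacesTouching.2 ⟨a, ha, this⟩

/-- at most two sides if one side is missing. [folklore] -/
private theorem card_filter_le_two_of_not {p : Fin 3 → Prop} [DecidablePred p] {j₀ : Fin 3} (h : ¬ p j₀) :
    #((Finset.univ : Finset (Fin 3)).filter p) ≤ 2 := by
  have hsub : (Finset.univ : Finset (Fin 3)).filter p ⊆ Finset.univ.erase j₀ := by
    intro j hj
    rw [Finset.mem_erase]
    exact ⟨fun e => h (e ▸ (Finset.mem_filter.1 hj).2), Finset.mem_univ _⟩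
  exact (Finset.card_le_card hsub).trans (by rw [Finset.card_erase_of_mem (Finset.mem_univ _)]; simp)

/-- a corner face has a side outside `hBonds` (the side joining its two outside vertices). [cite: KhristoforovSmirnov2021, §1.2 (loop configurations, pp. 3–4)] -/
theorem exists_side_not_mem_hBonds_of_corner {i : Fin 5} {F : HexVertex} (h : IsCornerFace D i F) :
    ∃ j : Fin 3, side F j ∉ hBonds D := by
  obtain ⟨w, -, hw1, hw2, -⟩ := isCornerFace_typeII D h
  refine ⟨w, fun hmem => ?_⟩
  obtain ⟨a, b, he, ha, -⟩ := exists_rep_of_mem_hBonds D hmem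
  unfold side at he
  rcases Sym2.eq_iff.1 he with ⟨h1, -⟩ | ⟨-, h2⟩
  · exact hw1 (h1 ▸ ha)
  · exact hw2 (h2 ▸ ha)

/-- **degrees in a six-odd-point configuration are at most two.** [cite: KhristoforovSmirnov2021, §1.2 (loop configurations, pp. 3–4)] -/
theorem xiDeg_le_two_of_mem_loopSpace6 {x x' : HexVertex} {u v : Site 2} (hadj : hexGraph.Adj x x') (he : faceEdge x x' = {u, v})
    (hu : u ∈ D.verts) {s : HexVertex} (hs : s = x ∨ s = x') {ξ : Finset (Sym2 (Site 2))} (hξ : ξ ∈ loopSpace6 D u v s)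
    (F : HexVertex) : xiDeg ξ F ≤ 2 := by
  classical
  unfold loopSpace6 at hξ
  obtain ⟨hsub, hpar⟩ := Finset.mem_filter.1 hξ
  have hsub' := Finset.mem_powerset.1 hsub
  by_cases hF : F ∈ triFacesTouching D.verts
  · by_cases hodd : Odd (xiDeg ξ F)
    · rcases (hpar F hF).1 hodd with ⟨i, hc⟩ | rfl
      · obtain ⟨j₀, hj₀⟩ := exists_side_not_mem_hBonds_of_corner D hc
        exact card_filter_le_two_of_not (j₀ := j₀) fun h => hj₀ (Finset.mem_of_mem_erase (hsub' h))
      · -- F = s: the bond s(u,v) is a side of s, not in ξ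
        have hinc : Inc F s(u, v) := by
          rcases hs with rfl | rfl
          · exact inc_mk_iff.2 ⟨Finset.mem_of_mem_inter_left (s₂ := hexFaceVertices x')
              (by rw [show hexFaceVertices F ∩ hexFaceVertices x' = faceEdge F x' from rfl, he]; simp),
              Finset.mem_of_mem_inter_left (s₂ := hexFaceVertices x')
              (by rw [show hexFaceVertices F ∩ hexFaceVertices x' = faceEdge F x' from rfl, he]; simp)⟩
          · exact inc_mk_iff.2 ⟨Finset.mem_of_mem_inter_right (s₁ := hexFaceVertices x)
              (by rw [show hexFaceVertices x ∩ hexFaceVertices F = faceEdge x F from rfl, he]; simp),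
              Finset.mem_of_mem_inter_right (s₁ := hexFaceVertices x)
              (by rw [show hexFaceVertices x ∩ hexFaceVertices F = faceEdge x F from rfl, he]; simp)⟩
        have huv : triGraph.Adj u v := by
          have hux : u ∈ hexFaceVertices x := Finset.mem_of_mem_inter_left (s₂ := hexFaceVertices x')
            (by rw [show hexFaceVertices x ∩ hexFaceVertices x' = faceEdge x x' from rfl, he]; simp)
          have hvx : v ∈ hexFaceVertices x := Finset.mem_of_mem_inter_left (s₂ := hexFaceVertices x')
            (by rw [show hexFaceVertices x ∩ hexFaceVertices x' = faceEdge x x' from rfl, he]; simp)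
          have hne : u ≠ v := by
            intro e
            have : #(faceEdge x x') = 2 := ((hexGraph_adj_iff x x').1 hadj).2
            rw [he, e] at this
            simp at this
          exact adj_of_mem_hexFaceVertices hux hvx hne
        obtain ⟨j₀, hj₀⟩ := exists_side_eq_of_inc D (mem_hBonds D huv (Or.inl hu)) hinc
        exact card_filter_le_two_of_not (j₀ := j₀) fun h => by
          have := Finset.mem_erase.1 (hsub' h)
          exact this.1 hj₀.symm
    · -- even and ≤ 3
      have h3 : xiDeg ξ F ≤ 3 := (Finset.card_filter_le _ _).trans (by simp)
      rcases Nat.even_or_odd (xiDeg ξ F) with ⟨k, hk⟩ | ho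
      · omega
      · exact absurd ho hodd
  · -- not touching: no side in hBonds
    have : xiDeg ξ F = 0 := by
      unfold xiDeg
      rw [Finset.card_eq_zero, Finset.filter_eq_empty_iff]
      intro j _ hj
      exact hF (mem_touching_of_side_mem D (Finset.mem_of_mem_erase (hsub' hj)))
    omega

/-- an edge of the side graph of `ξ ⊆ hBonds` starts at a face touching `G`. [cite: KhristoforovSmirnov2021, §1.2 (loop configurations, pp. 3–4)] -/
theorem sideGraph_adj_touching {ξ : Finset (Sym2 (Site 2))} (hξ : ξ ⊆ hBonds D) {F F' : HexVertex}
    (h : (sideGraph ξ).Adj F F') : F ∈ triFacesTouching D.verts := by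
  obtain ⟨j, -, hj⟩ := h
  exact mem_touching_of_side_mem D (hξ hj)

/-- the component of a touching face in the side graph of `ξ ⊆ hBonds` consists of touching faces (hence is finite). [cite: KhristoforovSmirnov2021, §1.2 (loop configurations, pp. 3–4)] -/
theorem supp_subset_touching {ξ : Finset (Sym2 (Site 2))} (hξ : ξ ⊆ hBonds D) {Y : HexVertex} (hY : Y ∈ triFacesTouching D.verts) :
    ((sideGraph ξ).connectedComponentMk Y).supp ⊆ ↑(triFacesTouching D.verts) := by
  intro F hF
  have hF' := (SimpleGraph.ConnectedComponent.mem_supp_iff _ _).1 hF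
  obtain ⟨p⟩ := SimpleGraph.ConnectedComponent.exact hF'
  cases p with
  | nil => exact hY
  | cons hadj _ => exact sideGraph_adj_touching D hξ hadj

/-- **the odd faces of a component of the side graph** (all side counts `≤ 2`): the number of faces of odd side count that a
given touching face reaches is EVEN and AT MOST TWO — packaged as: from an odd face `Y₁` one reaches an odd face `Y₂ ≠ Y₁`,
and no third. [cite: KhristoforovSmirnov2021, §1.2 (loop configurations, pp. 3–4)] -/
theorem odd_component {ξ : Finset (Sym2 (Site 2))} (hξ : ξ ⊆ hBonds D) (hdeg : ∀ F, xiDeg ξ F ≤ 2) {Y₁ : HexVertex}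
    (h1 : Y₁ ∈ triFacesTouching D.verts) (ho1 : Odd (xiDeg ξ Y₁)) :
    (∃ Y₂, Y₂ ≠ Y₁ ∧ Odd (xiDeg ξ Y₂) ∧ (sideGraph ξ).Reachable Y₁ Y₂) ∧
    (∀ Y₂ Y₃, (sideGraph ξ).Reachable Y₁ Y₂ → (sideGraph ξ).Reachable Y₁ Y₃ → Odd (xiDeg ξ Y₂) → Odd (xiDeg ξ Y₃) →
      Y₂ ≠ Y₁ → Y₃ ≠ Y₁ → Y₂ = Y₃) := by
  classical
  set C := (sideGraph ξ).connectedComponentMk Y₁ with hC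
  have hreach : ∀ F, (sideGraph ξ).Reachable Y₁ F → F ∈ C.supp := by
    intro F h
    rw [SimpleGraph.ConnectedComponent.mem_supp_iff, hC]
    exact (SimpleGraph.ConnectedComponent.sound h).symm
  have hreach' : ∀ F, F ∈ C.supp → (sideGraph ξ).Reachable Y₁ F := by
    intro F hF
    have hF' := (SimpleGraph.ConnectedComponent.mem_supp_iff _ _).1 hF
    rw [hC] at hF'
    exact (SimpleGraph.ConnectedComponent.exact hF').symm
  have hsub : ∀ v : C.supp, ∀ w : HexVertex, (sideGraph ξ).Adj v w → w ∈ C.supp := by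
    intro v w hw
    have hv := v.2
    rw [SimpleGraph.ConnectedComponent.mem_supp_iff] at hv ⊢
    rw [← hv]
    exact SimpleGraph.ConnectedComponent.sound hw.symm.reachable
  have hfin : (C.supp).Finite := (Finset.finite_toSet _).subset (supp_subset_touching D hξ h1)
  haveI : Fintype C.supp := hfin.fintype
  have hdegC : ∀ v : C.supp, C.toSimpleGraph.degree v = xiDeg ξ v := by
    intro v
    rw [← SimpleGraph.card_neighborFinset_eq_degree]
    unfold xiDeg
    symm
    refine Finset.card_bij (fun j hj => (⟨oppFace (v : HexVertex) j, hsub v _ ⟨j, rfl, (Finset.mem_filter.1 hj).2⟩⟩ : C.supp))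
      (fun j hj => ?_) (fun j₁ _ j₂ _ h => ?_) (fun w hw => ?_)
    · rw [SimpleGraph.mem_neighborFinset]
      exact ⟨j, rfl, (Finset.mem_filter.1 hj).2⟩
    · exact oppFace_injective' _ (congrArg Subtype.val h)
    · rw [SimpleGraph.mem_neighborFinset] at hw
      obtain ⟨j, hj, hb⟩ := hw
      exact ⟨j, Finset.mem_filter.2 ⟨Finset.mem_univ _, hb⟩, Subtype.ext hj.symm⟩
  have hle : ∀ v : C.supp, C.toSimpleGraph.degree v ≤ 2 := fun v => (hdegC v).symm ▸ hdeg v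
  have hone : ∀ v : C.supp, Odd (xiDeg ξ v) → C.toSimpleGraph.degree v = 1 := by
    intro v hv
    rw [← hdegC] at hv
    have := hle v
    obtain ⟨m, hm⟩ := hv
    omega
  constructor
  · -- existence: the odd-degree vertices of `C.toSimpleGraph` are even in number and contain `Y₁`
    have heven0 : Even #(Finset.univ.filter fun v : C.supp => Odd (C.toSimpleGraph.degree v)) :=
      SimpleGraph.even_card_odd_degree_vertices C.toSimpleGraph
    have hseteq : (Finset.univ.filter fun v : C.supp => Odd (C.toSimpleGraph.degree v)) =
        (Finset.univ.filter fun v : C.supp => Odd (xiDeg ξ (v : HexVertex))) := by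
      ext v
      simp only [Finset.mem_filter, Finset.mem_univ, true_and, hdegC]
    have heven : Even #(Finset.univ.filter fun v : C.supp => Odd (xiDeg ξ (v : HexVertex))) := by
      rw [← hseteq]; exact heven0
    have hY₁mem : (⟨Y₁, hreach _ SimpleGraph.Reachable.rfl⟩ : C.supp) ∈
        (Finset.univ.filter fun v : C.supp => Odd (xiDeg ξ (v : HexVertex))) :=
      Finset.mem_filter.2 ⟨Finset.mem_univ _, ho1⟩
    have hcard : 1 < #(Finset.univ.filter fun v : C.supp => Odd (xiDeg ξ (v : HexVertex))) := by
      have hpos : 0 < #(Finset.univ.filter fun v : C.supp => Odd (xiDeg ξ (v : HexVertex))) :=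
        Finset.card_pos.2 ⟨_, hY₁mem⟩
      obtain ⟨k, hk⟩ := heven
      omega
    obtain ⟨w, hw, hne⟩ := Finset.exists_mem_ne hcard ⟨Y₁, hreach _ SimpleGraph.Reachable.rfl⟩
    refine ⟨w, fun e => hne (Subtype.ext e), (Finset.mem_filter.1 hw).2, hreach' _ w.2⟩
  · -- at most two: three odd (= degree one) vertices contradict the handshake in a connected graph of max degree two
    intro Y₂ Y₃ h12 h13 ho2 ho3 n21 n31
    by_contra n23
    let S : Finset C.supp := {⟨Y₁, hreach _ SimpleGraph.Reachable.rfl⟩, ⟨Y₂, hreach _ h12⟩, ⟨Y₃, hreach _ h13⟩}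
    have hS : S.card = 3 := by
      refine Finset.card_eq_three.2 ⟨⟨Y₁, hreach _ SimpleGraph.Reachable.rfl⟩, ⟨Y₂, hreach _ h12⟩, ⟨Y₃, hreach _ h13⟩, ?_, ?_, ?_, rfl⟩
      · exact fun h => n21 (congrArg Subtype.val h).symm
      · exact fun h => n31 (congrArg Subtype.val h).symm
      · exact fun h => n23 (congrArg Subtype.val h)
    have hSone : ∀ w ∈ S, C.toSimpleGraph.degree w = 1 := by
      intro w hw
      simp only [S, Finset.mem_insert, Finset.mem_singleton] at hw
      rcases hw with rfl | rfl | rfl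
      · exact hone _ ho1
      · exact hone _ ho2
      · exact hone _ ho3
    have hbound : ∑ w : C.supp, C.toSimpleGraph.degree w + 3 ≤ 2 * Fintype.card C.supp := by
      have hterm : ∀ w : C.supp, C.toSimpleGraph.degree w + (if w ∈ S then 1 else 0) ≤ 2 := by
        intro w
        split_ifs with hw
        · rw [hSone w hw]
        · have := hle w; omega
      have hsum := Finset.sum_le_sum fun w (_ : w ∈ (Finset.univ : Finset C.supp)) => hterm w
      rw [Finset.sum_add_distrib, Finset.sum_const, smul_eq_mul, Finset.card_univ] at hsum
      have hind : ∑ w : C.supp, (if w ∈ S then 1 else 0) = 3 := by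
        rw [Finset.sum_boole, Finset.filter_mem_eq_inter, Finset.univ_inter, hS]; rfl
      omega
    have hhand := C.toSimpleGraph.sum_degrees_eq_twice_card_edges
    have hconn := (SimpleGraph.ConnectedComponent.connected_toSimpleGraph C).card_vert_le_card_edgeSet_add_one
    rw [Nat.card_eq_fintype_card, Nat.card_eq_fintype_card, ← SimpleGraph.edgeFinset_card] at hconn
    have hconn' : Fintype.card C.supp ≤ #C.toSimpleGraph.edgeFinset + 1 := hconn
    have hhand' : ∑ w : C.supp, C.toSimpleGraph.degree w = 2 * #C.toSimpleGraph.edgeFinset := hhand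
    omega

/-- two touching faces incident to the same `H_G`-bond: a third incident touching face is one of them. [cite: KhristoforovSmirnov2021, §1.2 (loop configurations, pp. 3–4)] -/
theorem eq_or_eq_of_inc_three {e : Sym2 (Site 2)} (he : e ∈ hBonds D) {F₁ F₂ F₃ : HexVertex}
    (h₁ : F₁ ∈ triFacesTouching D.verts) (h₂ : F₂ ∈ triFacesTouching D.verts) (h₃ : F₃ ∈ triFacesTouching D.verts)
    (i₁ : Inc F₁ e) (i₂ : Inc F₂ e) (i₃ : Inc F₃ e) (h12 : F₁ ≠ F₂) : F₃ = F₁ ∨ F₃ = F₂ := by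
  classical
  obtain ⟨a, b, rfl, ha, hab⟩ := exists_rep_of_mem_hBonds D he
  have hpair := filter_inc_eq_pair D ha hab
  have hmem : ∀ F, F ∈ triFacesTouching D.verts → Inc F s(a, b) → F = leftFace a b ∨ F = leftFace b a := by
    intro F hF hinc
    have : F ∈ (triFacesTouching D.verts).filter (fun F => Inc F s(a, b)) := Finset.mem_filter.2 ⟨hF, hinc⟩
    rw [hpair, Finset.mem_insert, Finset.mem_singleton] at this
    exact this
  rcases hmem F₁ h₁ i₁ with e1 | e1 <;> rcases hmem F₂ h₂ i₂ with e2 | e2 <;> rcases hmem F₃ h₃ i₃ with e3 | e3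
  · exact absurd (e1.trans e2.symm) h12
  · exact absurd (e1.trans e2.symm) h12
  · exact Or.inl (e3.trans e1.symm)
  · exact Or.inr (e3.trans e2.symm)
  · exact Or.inr (e3.trans e2.symm)
  · exact Or.inl (e3.trans e1.symm)
  · exact absurd (e1.trans e2.symm) h12
  · exact absurd (e1.trans e2.symm) h12

/-- a face with two distinct vertices in `G` is not a corner face. [cite: KhristoforovSmirnov2021, §1.2 (loop configurations, pp. 3–4)] -/
theorem not_corner_of_two_mem {F : HexVertex} {u v : Site 2} (hu : u ∈ hexFaceVertices F) (hv : v ∈ hexFaceVertices F)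
    (huG : u ∈ D.verts) (hvG : v ∈ D.verts) (huv : u ≠ v) (i : Fin 5) : ¬ IsCornerFace D i F := by
  intro hc
  obtain ⟨w, -, hw1, hw2, -⟩ := isCornerFace_typeII D hc
  have key : ∀ z ∈ hexFaceVertices F, z ∈ D.verts → z = faceVertex F w := by
    intro z hz hzG
    obtain ⟨i, rfl⟩ := mem_hexFaceVertices_iff_faceVertex.1 hz
    rcases fin3_cases₅ w i with e | e | e
    · rw [e]
    · exact absurd (e ▸ hzG) hw1
    · exact absurd (e ▸ hzG) hw2
  exact huv ((key u hu huG).trans (key v hv hvG).symm)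

/-- **removing the component of a face**: the sides of `ξ` not on any face reachable from `s₀`. The remaining set has side
count `0` on the component and the old side count off it, and linking off the component is unchanged. [cite: KhristoforovSmirnov2021, §1.2 (loop configurations, pp. 3–4)] -/
theorem restrict_off_component {ξ : Finset (Sym2 (Site 2))} (hξ : ξ ⊆ hBonds D) (s₀ : HexVertex)
    (ξ' : Finset (Sym2 (Site 2)))
    (hξ' : ∀ e, e ∈ ξ' ↔ e ∈ ξ ∧ ¬ ∃ F, (sideGraph ξ).Reachable s₀ F ∧ ∃ i : Fin 3, e = side F i) :
    (∀ F, (sideGraph ξ).Reachable s₀ F → xiDeg ξ' F = 0) ∧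
    (∀ F, ¬ (sideGraph ξ).Reachable s₀ F → xiDeg ξ' F = xiDeg ξ F) ∧
    (∀ Y Y', ¬ (sideGraph ξ).Reachable s₀ Y → (XiLinked ξ Y Y' ↔ XiLinked ξ' Y Y')) := by
  classical
  -- a side of an unreachable face lying in ξ is not a side of any reachable face
  have key : ∀ F (i : Fin 3), ¬ (sideGraph ξ).Reachable s₀ F → side F i ∈ ξ →
      ¬ ∃ F'', (sideGraph ξ).Reachable s₀ F'' ∧ ∃ i'' : Fin 3, side F i = side F'' i'' := by
    rintro F i hF hmem ⟨F'', hreach, i'', he⟩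
    have heB : side F i ∈ hBonds D := hξ hmem
    have h1 : F ∈ triFacesTouching D.verts := mem_touching_of_side_mem D heB
    have h2 : oppFace F i ∈ triFacesTouching D.verts :=
      mem_touching_of_side_mem D (j := oppIdx F i) (by rw [side_oppFace_oppIdx]; exact heB)
    have h3 : F'' ∈ triFacesTouching D.verts := mem_touching_of_side_mem D (j := i'') (by rw [← he]; exact heB)
    rcases eq_or_eq_of_inc_three D heB h1 h2 h3 (inc_side F i) (by rw [← side_oppFace_oppIdx F i]; exact inc_side _ _)
        (by rw [he]; exact inc_side _ _) (fun e => (hexGraph_adj_oppFace F i).ne e) with rfl | rfl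
    · exact hF hreach
    · exact hF (hreach.trans ⟨SimpleGraph.Walk.cons ⟨oppIdx F i, by rw [oppFace_oppFace], by rw [side_oppFace_oppIdx]; exact hmem⟩ SimpleGraph.Walk.nil⟩)
  refine ⟨fun F hF => ?_, fun F hF => ?_, fun Y Y' hY => ?_⟩
  · unfold xiDeg
    rw [Finset.card_eq_zero, Finset.filter_eq_empty_iff]
    intro i _ hi
    have := (hξ' _).1 hi
    exact this.2 ⟨F, hF, i, rfl⟩
  · unfold xiDeg
    congr 1
    refine Finset.filter_congr fun i _ => ?_
    rw [hξ']
    constructor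
    · exact fun h => h.1
    · exact fun h => ⟨h, key F i hF h⟩
  · constructor
    · intro h
      unfold XiLinked at h ⊢
      induction h with
      | refl => exact Relation.ReflTransGen.refl
      | @tail b c hab hbc ih =>
        obtain ⟨i, hc, hmem⟩ := hbc
        have hb : ¬ (sideGraph ξ).Reachable s₀ b := by
          intro hsb
          apply hY
          have hYb : (sideGraph ξ).Reachable Y b := (xiLinked_iff_reachable ξ Y b).1 hab
          exact hsb.trans hYb.symm
        refine ih.tail ⟨i, hc, ?_⟩
        rw [hξ']
        exact ⟨hmem, key b i hb hmem⟩
    · intro h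
      unfold XiLinked at h ⊢
      induction h with
      | refl => exact Relation.ReflTransGen.refl
      | tail _ hbc ih =>
        obtain ⟨i, hc, hmem⟩ := hbc
        exact ih.tail ⟨i, hc, ((hξ' _).1 hmem).1⟩

/-- reachability in the side graph of `ξ ⊆ hBonds` from a touching face stays among touching faces. [cite: KhristoforovSmirnov2021, §1.2 (loop configurations, pp. 3–4)] -/
theorem touching_of_reachable {ξ : Finset (Sym2 (Site 2))} (hξ : ξ ⊆ hBonds D) {Y F : HexVertex}
    (hY : Y ∈ triFacesTouching D.verts) (h : (sideGraph ξ).Reachable Y F) : F ∈ triFacesTouching D.verts := by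
  have := supp_subset_touching D hξ hY
    ((SimpleGraph.ConnectedComponent.mem_supp_iff _ _).2 (SimpleGraph.ConnectedComponent.sound h.symm))
  exact Finset.mem_coe.1 this

/-- Auxiliary. [folklore] -/
private theorem fin5_add_ne (j : Fin 5) : j + 1 ≠ j ∧ j + 2 ≠ j ∧ j + 4 ≠ j := by revert j; decide

/-- **N2 holds for every domain**: every six-odd-point configuration lies in exactly one class `W_{j,M}(s)`. The component of
`s` in the side graph is a path (all side counts `≤ 2`) ending at a unique corner `y_j`; deleting it leaves an element of
`loopSpace D j`, which is `ξ_{j}(σ)` for some colouring `σ` (`LoopSurj`), so exactly one of the patterns `A_j`, `B_j` links the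
remaining corners (the loop lemma), and these links avoid the deleted path. [cite: KhristoforovSmirnov2021, §1.2 (loop configurations, pp. 3–4)] -/
theorem sixStructure_holds : SixStructure D := by
  classical
  intro x x' u v hx hadj he hu hv s hs ξ hξ
  -- the inner bond and the face s
  have hI : hexFaceVertices x ∩ hexFaceVertices x' = {u, v} := he
  have hux : u ∈ hexFaceVertices x := Finset.mem_of_mem_inter_left (s₂ := hexFaceVertices x') (by rw [hI]; simp)
  have hvx : v ∈ hexFaceVertices x := Finset.mem_of_mem_inter_left (s₂ := hexFaceVertices x') (by rw [hI]; simp)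
  have hux' : u ∈ hexFaceVertices x' := Finset.mem_of_mem_inter_right (s₁ := hexFaceVertices x) (by rw [hI]; simp)
  have hvx' : v ∈ hexFaceVertices x' := Finset.mem_of_mem_inter_right (s₁ := hexFaceVertices x) (by rw [hI]; simp)
  have huv_ne : u ≠ v := by
    intro e
    have : #(faceEdge x x') = 2 := ((hexGraph_adj_iff x x').1 hadj).2
    rw [he, e] at this
    simp at this
  have hs' : s = x ∨ s = x' := by
    rcases Finset.mem_insert.1 hs with h | h
    · exact Or.inl h
    · exact Or.inr (Finset.mem_singleton.1 h)
  have hus : u ∈ hexFaceVertices s := by rcases hs' with rfl | rfl; exacts [hux, hux']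
  have hvs : v ∈ hexFaceVertices s := by rcases hs' with rfl | rfl; exacts [hvx, hvx']
  have hsT : s ∈ triFacesTouching D.verts := mem_triFacesTouching.2 ⟨u, hu, hus⟩
  have hs_not_corner : ∀ k, ¬ IsCornerFace D k s := fun k => not_corner_of_two_mem D hus hvs hu hv huv_ne k
  -- the configuration
  have hξ6 := hξ
  unfold loopSpace6 at hξ
  obtain ⟨hsub0, hpar⟩ := Finset.mem_filter.1 hξ
  have hsub : ξ ⊆ hBonds D := fun e he' => Finset.mem_of_mem_erase (Finset.mem_powerset.1 hsub0 he')
  have hdeg : ∀ F, xiDeg ξ F ≤ 2 := xiDeg_le_two_of_mem_loopSpace6 D hadj he hu hs' hξ6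
  have ho_s : Odd (xiDeg ξ s) := (hpar s hsT).2 (Or.inr rfl)
  -- the component of s is a path from s to a corner Yj
  obtain ⟨⟨Yj, hYj_ne, hYj_odd, hYj_reach⟩, huniq⟩ := odd_component D hsub hdeg hsT ho_s
  have hYjT : Yj ∈ triFacesTouching D.verts := touching_of_reachable D hsub hsT hYj_reach
  obtain ⟨j, hj⟩ : ∃ j : Fin 5, IsCornerFace D j Yj := by
    rcases (hpar Yj hYjT).1 hYj_odd with h | h
    · exact h
    · exact absurd h hYj_ne
  have hreach_corner : ∀ (k : Fin 5) (Y : HexVertex), IsCornerFace D k Y → (sideGraph ξ).Reachable s Y → Y = Yj := by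
    intro k Y hY hr
    have hYT := cornerFace_mem_touching D hY
    have hYodd : Odd (xiDeg ξ Y) := (hpar Y hYT).2 (Or.inl ⟨k, hY⟩)
    have hYs : Y ≠ s := fun e => hs_not_corner k (e ▸ hY)
    exact huniq Y Yj hr hYj_reach hYodd hYj_odd hYs hYj_ne
  have hnot_reach : ∀ (k : Fin 5) (Y : HexVertex), IsCornerFace D k Y → k ≠ j → ¬ (sideGraph ξ).Reachable s Y := by
    intro k Y hY hk hr
    have hYYj := hreach_corner k Y hY hr
    subst hYYj
    exact hk (cornerFace_idx_unique D hY hj)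
  -- delete the component of s
  set ξ' : Finset (Sym2 (Site 2)) := ξ.filter fun e => ¬ ∃ F, (sideGraph ξ).Reachable s F ∧ ∃ i : Fin 3, e = side F i
    with hξ'def
  have hξ' : ∀ e, e ∈ ξ' ↔ e ∈ ξ ∧ ¬ ∃ F, (sideGraph ξ).Reachable s F ∧ ∃ i : Fin 3, e = side F i := fun e => by
    rw [hξ'def, Finset.mem_filter]
  obtain ⟨hzero, hsame, hlink⟩ := restrict_off_component D hsub s ξ' hξ'
  have hξ'sub : ξ' ⊆ ξ := Finset.filter_subset _ _
  have hξ'mem : ξ' ∈ loopSpace D j := by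
    unfold loopSpace
    refine Finset.mem_filter.2 ⟨Finset.mem_powerset.2 (hξ'sub.trans hsub), fun F hF => ?_⟩
    by_cases hr : (sideGraph ξ).Reachable s F
    · rw [hzero F hr]
      constructor
      · intro h0; exact absurd h0 (by decide)
      · rintro ⟨k, hk, hcF⟩
        exact absurd hr (hnot_reach k F hcF hk)
    · rw [hsame F hr, hpar F hF]
      constructor
      · rintro (⟨k, hcF⟩ | hFs)
        · refine ⟨k, fun e => hr ?_, hcF⟩
          subst e
          rw [cornerFace_unique D hcF hj]
          exact hYj_reach
        · subst hFs
          exact absurd SimpleGraph.Reachable.rfl hr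
      · rintro ⟨k, -, hcF⟩
        exact Or.inl ⟨k, hcF⟩
  -- a colouring realising ξ', and the remaining corners
  obtain ⟨σ, hσ⟩ := loopSurj_holds D j false ξ' hξ'mem
  obtain ⟨Y1, hY1⟩ := cornerFace_exists D (j + 1)
  obtain ⟨Y2, hY2⟩ := cornerFace_exists D (j + 2)
  obtain ⟨Y4, hY4⟩ := cornerFace_exists D (j + 4)
  have hY1nr : ¬ (sideGraph ξ).Reachable s Y1 := hnot_reach (j + 1) Y1 hY1 (fin5_add_ne j).1
  have hA : XiLinked ξ Y1 Y2 ↔ MatchA D σ j false := by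
    rw [hlink Y1 Y2 hY1nr, ← hσ, xiLinked_xiOf_iff]
    unfold MatchA
    constructor
    · intro h; exact ⟨Y1, Y2, hY1, hY2, h⟩
    · rintro ⟨Y1', Y2', h1, h2, h⟩
      rw [cornerFace_unique D hY1 h1, cornerFace_unique D hY2 h2]; exact h
  have hB : XiLinked ξ Y1 Y4 ↔ MatchB D σ j false := by
    rw [hlink Y1 Y4 hY1nr, ← hσ, xiLinked_xiOf_iff]
    unfold MatchB
    constructor
    · intro h; exact ⟨Y1, Y4, hY1, hY4, h⟩
    · rintro ⟨Y1', Y4', h1, h4, h⟩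
      rw [cornerFace_unique D hY1 h1, cornerFace_unique D hY4 h4]; exact h
  have hxor : Xor (MatchA D σ j false) (MatchB D σ j false) := (fiveMarkedLoopLemma_holds D σ j).1
  have hYj_linked : XiLinked ξ s Yj := (xiLinked_iff_reachable ξ s Yj).2 hYj_reach
  -- existence and uniqueness of the class
  refine ⟨(j, decide (MatchB D σ j false)), ?_, ?_⟩
  · show InClass D u v s j (decide (MatchB D σ j false)) ξ
    refine ⟨hξ6, ⟨Yj, hj, hYj_linked⟩, ?_⟩
    by_cases hBm : MatchB D σ j false
    · simp only [hBm, decide_true, ↓reduceIte]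
      exact ⟨Y1, Y4, hY1, hY4, hB.2 hBm⟩
    · simp only [hBm, decide_false, Bool.false_eq_true, ↓reduceIte]
      have hAm : MatchA D σ j false := by
        rcases hxor with ⟨h, -⟩ | ⟨h, -⟩
        · exact h
        · exact absurd h hBm
      exact ⟨Y1, Y2, hY1, hY2, hA.2 hAm⟩
  · rintro ⟨j', m'⟩ hp
    obtain ⟨-, ⟨Y', hY'c, hY'l⟩, Y1', Y2', h1', h2', hl'⟩ := hp
    dsimp only at hY'c h1' h2'
    have hY'r : (sideGraph ξ).Reachable s Y' := (xiLinked_iff_reachable ξ s Y').1 hY'l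
    have hY'Yj := hreach_corner j' Y' hY'c hY'r
    subst hY'Yj
    have hjj : j' = j := cornerFace_idx_unique D hY'c hj
    subst hjj
    have hY1' : Y1' = Y1 := cornerFace_unique D h1' hY1
    subst hY1'
    cases m'
    · simp only [Bool.false_eq_true, ↓reduceIte] at h2'
      have hY2' : Y2' = Y2 := cornerFace_unique D h2' hY2
      subst hY2'
      have hAm : MatchA D σ j' false := hA.1 hl'
      have hBm : ¬ MatchB D σ j' false := by
        rcases hxor with ⟨-, h⟩ | ⟨-, h⟩
        · exact h
        · exact absurd hAm h
      simp only [hBm, decide_false]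
    · simp only [↓reduceIte] at h2'
      have hY2' : Y2' = Y4 := cornerFace_unique D h2' hY4
      subst hY2'
      have hBm : MatchB D σ j' false := hB.1 hl'
      simp only [hBm, decide_true]

/-! ### N3 TYPED PIECES (b-engine-2 g5, 22:15Z): the K5′ transport as the involution `A ↦ A ∆ γ(IP(A))`

Fix the inner edge `{x, x'}` (dual bond `b₀ = s(u, v)`), a corner index `j` and a pattern bit `m`. All edge sets below live in
`hBonds D` (colouring side) or in `E₀ := (hBonds D).erase b₀` (the transport). `IP_j(A)` = the faces reachable in the side graph of `A`
from one of the four corners `y_i, i ≠ j`. THE CHAIN: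
`#{T ⊆ G : Match_m ∧ (x or x' Joined to y_j)}` =(B1, colourings ↔ loop configurations) `#domR` =(B2, erase b₀) `#domD`
=(A, the involution `A ↦ A ∆ γ(IP_j(A))` with ONE transport set `γ(V)` chosen per interface vertex set `V`) `#codW` =(C) `#W_{j,m}(x) + #W_{j,m}(x')`.
The transport set needs NO connectedness: any `γ ⊆ E₀` avoiding the faces of `V`, odd exactly at `y_j` and at `t ∈ {x, x'}`. -/

/-- the corner face `y_i` (exists and is unique: `cornerFace_exists`, `cornerFace_unique`). [folklore] -/
noncomputable def yc (i : Fin 5) : HexVertex := (cornerFace_exists D i).choose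

/-- Auxiliary. [cite: KhristoforovSmirnov2021, §1.2 (loop configurations, pp. 3–4)] -/
theorem yc_spec (i : Fin 5) : IsCornerFace D i (yc D i) := (cornerFace_exists D i).choose_spec

/-- Auxiliary. [cite: KhristoforovSmirnov2021, §1.2 (loop configurations, pp. 3–4)] -/
theorem eq_yc {i : Fin 5} {Y : HexVertex} (h : IsCornerFace D i Y) : Y = yc D i := cornerFace_unique D h (yc_spec D i)

/-- Auxiliary. [cite: KhristoforovSmirnov2021, §1.2 (loop configurations, pp. 3–4)] -/
theorem yc_injective : Function.Injective (yc D) := fun i i' h =>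
  cornerFace_idx_unique D (yc_spec D i) (h ▸ yc_spec D i')

/-- Auxiliary. [cite: KhristoforovSmirnov2021, §1.2 (loop configurations, pp. 3–4)] -/
theorem isCornerFace_iff_eq_yc {i : Fin 5} {Y : HexVertex} : IsCornerFace D i Y ↔ Y = yc D i :=
  ⟨eq_yc D, fun h => h ▸ yc_spec D i⟩

/-- `F` lies on an interface of `A` from one of the four corners `≠ j`. [cite: KhristoforovSmirnov2021, §1.2 (loop configurations, pp. 3–4)] -/
def ipv (j : Fin 5) (A : Finset (Sym2 (Site 2))) (F : HexVertex) : Prop :=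
  ∃ i : Fin 5, i ≠ j ∧ (sideGraph A).Reachable (yc D i) F

/-- `t` is joined to `y_j` by `E`-steps through faces off the interfaces of `A` (`E = hBonds D`: along `H_G`; `E = E₀`: avoiding `b₀`). [cite: KhristoforovSmirnov2021, §1.2 (loop configurations, pp. 3–4)] -/
def JoinedOff (E : Finset (Sym2 (Site 2))) (j : Fin 5) (A : Finset (Sym2 (Site 2))) (t : HexVertex) : Prop :=
  ¬ ipv D j A t ∧ ¬ ipv D j A (yc D j) ∧
    Relation.ReflTransGen (fun F F' => (sideGraph E).Adj F F' ∧ ¬ ipv D j A F ∧ ¬ ipv D j A F') (yc D j) t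

/-- pattern `A_j` (`m = false`: `y_{j+1} ~ y_{j+2}`) resp. `B_j` (`m = true`: `y_{j+1} ~ y_{j+4}`) read in an abstract edge set. [cite: KhristoforovSmirnov2021, §1.2 (loop configurations, pp. 3–4)] -/
def patm (j : Fin 5) (m : Bool) (A : Finset (Sym2 (Site 2))) : Prop :=
  XiLinked A (yc D (j + 1)) (yc D (if m then j + 4 else j + 2))

/-- parity profile: the odd touching faces of `A` are exactly the members of `U`. [cite: KhristoforovSmirnov2021, §1.2 (loop configurations, pp. 3–4)] -/
def ParityIs (A : Finset (Sym2 (Site 2))) (U : Finset HexVertex) : Prop :=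
  ∀ F ∈ triFacesTouching D.verts, (Odd (xiDeg A F) ↔ F ∈ U)

/-- the five corner faces. [folklore] -/
noncomputable def corners : Finset HexVertex := Finset.univ.image (yc D)

/-- the four corner faces `y_i, i ≠ j`. [folklore] -/
noncomputable def cornersNe (j : Fin 5) : Finset HexVertex := (Finset.univ.filter fun i : Fin 5 => i ≠ j).image (yc D)

open Classical in
/-- `domR`: loop configurations with odd faces `{y_i : i ≠ j}` (`loopSpace D j`), pattern `m`, and `x` or `x'` joined to `y_j` off the
interfaces ALONG `H_G` (the edge `{x, x'}` allowed) — the image of the colouring event under `T ↦ ξ_{j,c}(T)`. [folklore] -/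
noncomputable def domR (x x' : HexVertex) (j : Fin 5) (m : Bool) : Finset (Finset (Sym2 (Site 2))) :=
  (loopSpace D j).filter fun B => patm D j m B ∧ (JoinedOff D (hBonds D) j B x ∨ JoinedOff D (hBonds D) j B x')

open Classical in
/-- `domD` (transport domain): subsets of `E₀ = hBonds ∖ {b₀}` with odd faces `{y_i : i ≠ j}` or `{y_i : i ≠ j} ∪ {x, x'}` (= `domR` after
erasing `b₀`), pattern `m`, and `x` or `x'` joined to `y_j` off the interfaces AVOIDING `b₀`. [folklore] -/
noncomputable def domD (x x' : HexVertex) (u v : Site 2) (j : Fin 5) (m : Bool) : Finset (Finset (Sym2 (Site 2))) :=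
  ((hBonds D).erase s(u, v)).powerset.filter fun A =>
    (ParityIs D A (cornersNe D j) ∨ ParityIs D A (cornersNe D j ∪ {x, x'})) ∧ patm D j m A ∧
      (JoinedOff D ((hBonds D).erase s(u, v)) j A x ∨ JoinedOff D ((hBonds D).erase s(u, v)) j A x')

open Classical in
/-- `codW` (transport codomain) = `W_{j,m}(x) ⊔ W_{j,m}(x')`: subsets of `E₀` with odd faces = the five corners and `s ∈ {x, x'}`, `s`
linked to `y_j`, pattern `m`. [folklore] -/
noncomputable def codW (x x' : HexVertex) (u v : Site 2) (j : Fin 5) (m : Bool) : Finset (Finset (Sym2 (Site 2))) :=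
  ((hBonds D).erase s(u, v)).powerset.filter fun A =>
    ∃ s ∈ ({x, x'} : Finset HexVertex), ParityIs D A (insert s (corners D)) ∧ (sideGraph A).Reachable s (yc D j) ∧ patm D j m A

/-- a TRANSPORT SET for the interface vertex set `V`: avoids `b₀` and the faces of `V`, odd exactly at `y_j` and at `t ∈ {x, x'}`. [cite: KhristoforovSmirnov2021, §1.2 (loop configurations, pp. 3–4)] -/
def GoodSet (x x' : HexVertex) (u v : Site 2) (j : Fin 5) (V : Finset HexVertex) (γ : Finset (Sym2 (Site 2))) (t : HexVertex) : Prop :=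
  (t = x ∨ t = x') ∧ γ ⊆ (hBonds D).erase s(u, v) ∧ (∀ e ∈ γ, ∀ F ∈ V, ¬ Inc F e) ∧
    ∀ F ∈ triFacesTouching D.verts, (Odd (xiDeg γ F) ↔ (F = yc D j ∨ F = t))

open Classical in
/-- ONE transport set per interface vertex set (`∅` if none exists). [folklore] -/
noncomputable def gam (x x' : HexVertex) (u v : Site 2) (j : Fin 5) (V : Finset HexVertex) : Finset (Sym2 (Site 2)) :=
  if h : ∃ p : Finset (Sym2 (Site 2)) × HexVertex, GoodSet D x x' u v j V p.1 p.2 then (Classical.choose h).1 else ∅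

open Classical in
/-- the interface vertex set `IP_j(A)` as a finset of touching faces. [folklore] -/
noncomputable def ipvSet (j : Fin 5) (A : Finset (Sym2 (Site 2))) : Finset HexVertex :=
  (triFacesTouching D.verts).filter fun F => ipv D j A F

/-- THE TRANSPORT MAP `Φ(A) = A ∆ γ(IP_j(A))` (an involution exchanging `domD` and `codW`). [folklore] -/
noncomputable def Phi (x x' : HexVertex) (u v : Site 2) (j : Fin 5) (A : Finset (Sym2 (Site 2))) : Finset (Sym2 (Site 2)) :=
  symmDiff A (gam D x x' u v j (ipvSet D j A))

/-! #### the faces (each a separate deliverable; assembly `sixTransport_of_faces` proved below) -/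

open Classical in
/-- **N3-B1 (colourings ↔ loop configurations)**: for every `c`, `T ↦ ξ_{j,c}(T)` carries `{T ⊆ G : Match_m ∧ (x or x' Joined)}` onto
`domR` (`loopInj/loopSurj/loopImage_holds`, `xiLinked_xiOf_iff`, `InInterface ↔ ipv`, `HStep ↔ sideGraph (hBonds D)`). No hypothesis on
`x, x'` is needed. [cite: KhristoforovSmirnov2021, §1.2 (loop configurations, pp. 3–4)] -/
def TransportColour (D : TriMarkedDomain 5) : Prop :=
  ∀ (x x' : HexVertex) (c : Bool) (j : Fin 5) (m : Bool),
    #(D.verts.powerset.filter fun T : Finset (Site 2) =>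
        (if m then MatchB D (↑T : Set (Site 2)) j c else MatchA D (↑T : Set (Site 2)) j c) ∧
          (Joined D (↑T : Set (Site 2)) j c x ∨ Joined D (↑T : Set (Site 2)) j c x')) =
      #(domR D x x' j m)

/-- **N3-B2 (erase `b₀`)**: `B ↦ B.erase b₀` is a bijection `domR → domD` (when `b₀ ∈ B` the faces `x, x'` lie on a loop of `B` off the
interfaces, so the interfaces and the pattern are unchanged and the odd set becomes `{y_i : i ≠ j} ∪ {x, x'}`; a joining chain through
the edge `{x, x'}` is cut at its first visit to `{x, x'}`). [cite: KhristoforovSmirnov2021, §1.2 (loop configurations, pp. 3–4)] -/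
def TransportErase (D : TriMarkedDomain 5) : Prop :=
  ∀ (x x' : HexVertex) (u v : Site 2), hexFaceVertices x ⊆ D.verts → hexGraph.Adj x x' → faceEdge x x' = {u, v} →
    u ∈ D.verts → v ∈ D.verts → ∀ (j : Fin 5) (m : Bool), #(domR D x x' j m) = #(domD D x x' u v j m)

/-- **N3-A (the involution)**: `#domD = #codW` via `Φ(A) = A ∆ γ(IP_j(A))`: `γ` avoids the interface faces, so `IP_j(Φ A) = IP_j(A)`
(hence `Φ (Φ A) = A` and the pattern is kept), and the parity profile moves by `{y_j, t}`. [cite: KhristoforovSmirnov2021, §1.2 (loop configurations, pp. 3–4)] -/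
def TransportCore (D : TriMarkedDomain 5) : Prop :=
  ∀ (x x' : HexVertex) (u v : Site 2), hexFaceVertices x ⊆ D.verts → hexGraph.Adj x x' → faceEdge x x' = {u, v} →
    u ∈ D.verts → v ∈ D.verts → ∀ (j : Fin 5) (m : Bool), #(domD D x x' u v j m) = #(codW D x x' u v j m)

open Classical in
/-- **N3-C (split)**: `codW = W_{j,m}(x) ⊔ W_{j,m}(x')` (disjoint: the parity of `x` differs). [cite: KhristoforovSmirnov2021, §1.2 (loop configurations, pp. 3–4)] -/
def TransportSplit (D : TriMarkedDomain 5) : Prop :=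
  ∀ (x x' : HexVertex) (u v : Site 2), hexFaceVertices x ⊆ D.verts → hexGraph.Adj x x' → faceEdge x x' = {u, v} →
    u ∈ D.verts → v ∈ D.verts → ∀ (j : Fin 5) (m : Bool),
      #(codW D x x' u v j m) =
        #((loopSpace6 D u v x).filter fun ξ => InClass D u v x j m ξ) +
          #((loopSpace6 D u v x').filter fun ξ => InClass D u v x' j m ξ)

/-- (L1) **parity of side counts is additive under symmetric difference.** [cite: KhristoforovSmirnov2021, §1.2 (loop configurations, pp. 3–4)] -/
def XorDeg : Prop :=
  ∀ (A B : Finset (Sym2 (Site 2))) (F : HexVertex), Odd (xiDeg (symmDiff A B) F) ↔ ¬ (Odd (xiDeg A F) ↔ Odd (xiDeg B F))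

/-- (L2) **XOR with an edge set avoiding every face reachable from `Y` does not change reachability from `Y`.** [cite: KhristoforovSmirnov2021, §1.2 (loop configurations, pp. 3–4)] -/
def ReachXor : Prop :=
  ∀ (A γ : Finset (Sym2 (Site 2))) (Y : HexVertex), (∀ e ∈ γ, ∀ F, (sideGraph A).Reachable Y F → ¬ Inc F e) →
    ∀ F, (sideGraph (symmDiff A γ)).Reachable Y F ↔ (sideGraph A).Reachable Y F

/-- (L3) **a chain of `E`-steps through `P`-faces is shadowed by an edge set** `γ ⊆ E` touching only `P`-faces, odd exactly at the two
ends (XOR-accumulate the bonds of the chain; a bond of `hBonds` has exactly two touching faces, `eq_or_eq_of_inc_three`). [cite: KhristoforovSmirnov2021, §1.2 (loop configurations, pp. 3–4)] -/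
def ChainEdgeSet (D : TriMarkedDomain 5) : Prop :=
  ∀ (E : Finset (Sym2 (Site 2))), E ⊆ hBonds D → ∀ (P : HexVertex → Prop) (a b : HexVertex),
    Relation.ReflTransGen (fun F F' => (sideGraph E).Adj F F' ∧ P F ∧ P F') a b →
      ∃ γ ⊆ E, (∀ e ∈ γ, ∀ F ∈ triFacesTouching D.verts, Inc F e → P F) ∧
        ∀ F ∈ triFacesTouching D.verts, (Odd (xiDeg γ F) ↔ Xor (F = a) (F = b))

/-- **N3 assembly: the four faces give `SixTransport D`** (real proof). [cite: KhristoforovSmirnov2021, §1.2 (loop configurations, pp. 3–4)] -/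
theorem sixTransport_of_faces (hB1 : TransportColour D) (hB2 : TransportErase D) (hA : TransportCore D) (hC : TransportSplit D) :
    SixTransport D := by
  intro x x' u v hx hadj he hu hv c j m
  rw [← hC x x' u v hx hadj he hu hv j m, ← hA x x' u v hx hadj he hu hv j m, ← hB2 x x' u v hx hadj he hu hv j m]
  exact (hB1 x x' c j m).symm

/-! #### N3-A, the involution — proved below modulo the three small faces (L1)–(L3) -/

/-- Auxiliary. [cite: KhristoforovSmirnov2021, §1.2 (loop configurations, pp. 3–4)] -/
theorem mem_corners {F : HexVertex} : F ∈ corners D ↔ ∃ i, F = yc D i := by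
  unfold corners
  rw [Finset.mem_image]
  constructor
  · rintro ⟨i, -, rfl⟩; exact ⟨i, rfl⟩
  · rintro ⟨i, rfl⟩; exact ⟨i, Finset.mem_univ _, rfl⟩

/-- Auxiliary. [cite: KhristoforovSmirnov2021, §1.2 (loop configurations, pp. 3–4)] -/
theorem mem_cornersNe {j : Fin 5} {F : HexVertex} : F ∈ cornersNe D j ↔ ∃ i, i ≠ j ∧ F = yc D i := by
  unfold cornersNe
  rw [Finset.mem_image]
  constructor
  · rintro ⟨i, hi, rfl⟩; exact ⟨i, (Finset.mem_filter.1 hi).2, rfl⟩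
  · rintro ⟨i, hi, rfl⟩; exact ⟨i, Finset.mem_filter.2 ⟨Finset.mem_univ _, hi⟩, rfl⟩

/-- Auxiliary. [cite: KhristoforovSmirnov2021, §1.2 (loop configurations, pp. 3–4)] -/
theorem yc_mem_corners (i : Fin 5) : yc D i ∈ corners D := (mem_corners D).2 ⟨i, rfl⟩

/-- Auxiliary. [cite: KhristoforovSmirnov2021, §1.2 (loop configurations, pp. 3–4)] -/
theorem yc_not_mem_cornersNe (j : Fin 5) : yc D j ∉ cornersNe D j := fun h => by
  obtain ⟨i, hi, h⟩ := (mem_cornersNe D).1 h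
  exact hi (yc_injective D h).symm

/-- Auxiliary. [cite: KhristoforovSmirnov2021, §1.2 (loop configurations, pp. 3–4)] -/
theorem yc_mem_cornersNe {i j : Fin 5} (h : i ≠ j) : yc D i ∈ cornersNe D j := (mem_cornersNe D).2 ⟨i, h, rfl⟩

/-- Auxiliary. [cite: KhristoforovSmirnov2021, §1.2 (loop configurations, pp. 3–4)] -/
theorem mem_corners_iff_or (j : Fin 5) {F : HexVertex} : F ∈ corners D ↔ F = yc D j ∨ F ∈ cornersNe D j := by
  rw [mem_corners, mem_cornersNe]
  constructor
  · rintro ⟨i, rfl⟩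
    by_cases hij : i = j
    · exact Or.inl (by rw [hij])
    · exact Or.inr ⟨i, hij, rfl⟩
  · rintro (h | ⟨i, -, h⟩)
    · exact ⟨j, h⟩
    · exact ⟨i, h⟩

/-- Auxiliary. [cite: KhristoforovSmirnov2021, §1.2 (loop configurations, pp. 3–4)] -/
theorem cornersNe_subset_corners (j : Fin 5) : cornersNe D j ⊆ corners D := fun _ h => (mem_corners_iff_or D j).2 (Or.inr h)

/-- Auxiliary. [cite: KhristoforovSmirnov2021, §1.2 (loop configurations, pp. 3–4)] -/
theorem not_mem_corners_iff {F : HexVertex} : F ∉ corners D ↔ ∀ i, ¬ IsCornerFace D i F := by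
  rw [mem_corners, not_exists]
  exact forall_congr' fun i => by rw [isCornerFace_iff_eq_yc]

/-- Auxiliary. [cite: KhristoforovSmirnov2021, §1.2 (loop configurations, pp. 3–4)] -/
theorem yc_mem_touching (i : Fin 5) : yc D i ∈ triFacesTouching D.verts := cornerFace_mem_touching D (yc_spec D i)

/-- parity shift, `{y_i : i ≠ j} ⊕ {y_j, t} = corners ∪ {t}`. [cite: KhristoforovSmirnov2021, §1.2 (loop configurations, pp. 3–4)] -/
theorem parity_shift₁ (j : Fin 5) {t : HexVertex} (ht : t ∉ corners D) (F : HexVertex) :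
    (¬ (F ∈ cornersNe D j ↔ (F = yc D j ∨ F = t))) ↔ F ∈ insert t (corners D) := by
  rw [Finset.mem_insert, mem_corners_iff_or D j]
  have h1 := yc_not_mem_cornersNe D j
  have h2 : t ∉ cornersNe D j := fun h => ht (cornersNe_subset_corners D j h)
  have h3 : yc D j ≠ t := fun h => ht (h ▸ yc_mem_corners D j)
  by_cases hFj : F = yc D j
  · subst hFj; tauto
  · by_cases hFt : F = t
    · subst hFt; tauto
    · tauto

/-- parity shift, `({y_i : i ≠ j} ∪ {t, t'}) ⊕ {y_j, t} = corners ∪ {t'}`. [cite: KhristoforovSmirnov2021, §1.2 (loop configurations, pp. 3–4)] -/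
theorem parity_shift₂ (j : Fin 5) {t t' : HexVertex} (ht : t ∉ corners D) (ht' : t' ∉ corners D) (htt' : t ≠ t') (F : HexVertex) :
    (¬ (F ∈ cornersNe D j ∪ {t, t'} ↔ (F = yc D j ∨ F = t))) ↔ F ∈ insert t' (corners D) := by
  rw [Finset.mem_union, Finset.mem_insert, Finset.mem_singleton, Finset.mem_insert, mem_corners_iff_or D j]
  have h1 := yc_not_mem_cornersNe D j
  have h2 : t ∉ cornersNe D j := fun h => ht (cornersNe_subset_corners D j h)
  have h2' : t' ∉ cornersNe D j := fun h => ht' (cornersNe_subset_corners D j h)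
  have h3 : yc D j ≠ t := fun h => ht (h ▸ yc_mem_corners D j)
  have h3' : yc D j ≠ t' := fun h => ht' (h ▸ yc_mem_corners D j)
  by_cases hFj : F = yc D j
  · subst hFj; tauto
  · by_cases hFt : F = t
    · subst hFt; tauto
    · by_cases hFt' : F = t'
      · subst hFt'; tauto
      · tauto

/-- Auxiliary. [cite: KhristoforovSmirnov2021, §1.2 (loop configurations, pp. 3–4)] -/
theorem xor_swap {a b q : Prop} (h : ¬ (a ↔ q) ↔ b) : (¬ (b ↔ q) ↔ a) := by tauto

/-- **all side counts are at most two** when the odd faces are corners or ends of the inner edge and `b₀` is excluded. [cite: KhristoforovSmirnov2021, §1.2 (loop configurations, pp. 3–4)] -/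
theorem xiDeg_le_two_of_odd_imp {x x' : HexVertex} {u v : Site 2} (hadj : hexGraph.Adj x x') (he : faceEdge x x' = {u, v})
    (hu : u ∈ D.verts) {A : Finset (Sym2 (Site 2))} (hA : A ⊆ (hBonds D).erase s(u, v))
    (hodd : ∀ F ∈ triFacesTouching D.verts, Odd (xiDeg A F) → (∃ i, IsCornerFace D i F) ∨ (F = x ∨ F = x')) (F : HexVertex) :
    xiDeg A F ≤ 2 := by
  classical
  by_cases hF : F ∈ triFacesTouching D.verts
  · by_cases ho : Odd (xiDeg A F)
    · rcases hodd F hF ho with ⟨i, hc⟩ | hs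
      · obtain ⟨j₀, hj₀⟩ := exists_side_not_mem_hBonds_of_corner D hc
        exact card_filter_le_two_of_not (j₀ := j₀) fun h => hj₀ (Finset.mem_of_mem_erase (hA h))
      · have hinc : Inc F s(u, v) := by
          rcases hs with rfl | rfl
          · exact inc_mk_iff.2 ⟨Finset.mem_of_mem_inter_left (s₂ := hexFaceVertices x')
              (by rw [show hexFaceVertices F ∩ hexFaceVertices x' = faceEdge F x' from rfl, he]; simp),
              Finset.mem_of_mem_inter_left (s₂ := hexFaceVertices x')
              (by rw [show hexFaceVertices F ∩ hexFaceVertices x' = faceEdge F x' from rfl, he]; simp)⟩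
          · exact inc_mk_iff.2 ⟨Finset.mem_of_mem_inter_right (s₁ := hexFaceVertices x)
              (by rw [show hexFaceVertices x ∩ hexFaceVertices F = faceEdge x F from rfl, he]; simp),
              Finset.mem_of_mem_inter_right (s₁ := hexFaceVertices x)
              (by rw [show hexFaceVertices x ∩ hexFaceVertices F = faceEdge x F from rfl, he]; simp)⟩
        have huv : triGraph.Adj u v := by
          have hux : u ∈ hexFaceVertices x := Finset.mem_of_mem_inter_left (s₂ := hexFaceVertices x')
            (by rw [show hexFaceVertices x ∩ hexFaceVertices x' = faceEdge x x' from rfl, he]; simp)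
          have hvx : v ∈ hexFaceVertices x := Finset.mem_of_mem_inter_left (s₂ := hexFaceVertices x')
            (by rw [show hexFaceVertices x ∩ hexFaceVertices x' = faceEdge x x' from rfl, he]; simp)
          have hne : u ≠ v := by
            intro e
            have : #(faceEdge x x') = 2 := ((hexGraph_adj_iff x x').1 hadj).2
            rw [he, e] at this
            simp at this
          exact adj_of_mem_hexFaceVertices hux hvx hne
        obtain ⟨j₀, hj₀⟩ := exists_side_eq_of_inc D (mem_hBonds D huv (Or.inl hu)) hinc
        exact card_filter_le_two_of_not (j₀ := j₀) fun h => by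
          have := Finset.mem_erase.1 (hA h)
          exact this.1 hj₀.symm
    · have h3 : xiDeg A F ≤ 3 := (Finset.card_filter_le _ _).trans (by simp)
      rcases Nat.even_or_odd (xiDeg A F) with ⟨k, hk⟩ | ho'
      · omega
      · exact absurd ho' ho
  · have : xiDeg A F = 0 := by
      unfold xiDeg
      rw [Finset.card_eq_zero, Finset.filter_eq_empty_iff]
      intro j _ hj
      exact hF (mem_touching_of_side_mem D (Finset.mem_of_mem_erase (hA hj)))
    omega

/-- the chosen transport set is one. [cite: KhristoforovSmirnov2021, §1.2 (loop configurations, pp. 3–4)] -/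
theorem gam_good {x x' : HexVertex} {u v : Site 2} {j : Fin 5} {V : Finset HexVertex}
    (h : ∃ γ t, GoodSet D x x' u v j V γ t) : ∃ t, GoodSet D x x' u v j V (gam D x x' u v j V) t := by
  classical
  have h' : ∃ p : Finset (Sym2 (Site 2)) × HexVertex, GoodSet D x x' u v j V p.1 p.2 := by
    obtain ⟨γ, t, hγ⟩ := h
    exact ⟨(γ, t), hγ⟩
  unfold gam
  rw [dif_pos h']
  exact ⟨(Classical.choose h').2, Classical.choose_spec h'⟩

/-- a face incident to a bond of `A` at a face reachable from `s` is reachable from `s`. [cite: KhristoforovSmirnov2021, §1.2 (loop configurations, pp. 3–4)] -/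
theorem reach_of_inc {A : Finset (Sym2 (Site 2))} (hA : A ⊆ hBonds D) {s F'' F : HexVertex} {i'' : Fin 3}
    (hr : (sideGraph A).Reachable s F'') (hmem : side F'' i'' ∈ A) (hF : F ∈ triFacesTouching D.verts)
    (hinc : Inc F (side F'' i'')) : (sideGraph A).Reachable s F := by
  have heB : side F'' i'' ∈ hBonds D := hA hmem
  have h1 : F'' ∈ triFacesTouching D.verts := mem_touching_of_side_mem D heB
  have h2 : oppFace F'' i'' ∈ triFacesTouching D.verts :=
    mem_touching_of_side_mem D (j := oppIdx F'' i'') (by rw [side_oppFace_oppIdx]; exact heB)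
  rcases eq_or_eq_of_inc_three D heB h1 h2 hF (inc_side F'' i'') (by rw [← side_oppFace_oppIdx F'' i'']; exact inc_side _ _)
      hinc (fun e => (hexGraph_adj_oppFace F'' i'').ne e) with rfl | rfl
  · exact hr
  · exact hr.trans ⟨SimpleGraph.Walk.cons ⟨i'', rfl, hmem⟩ SimpleGraph.Walk.nil⟩

/-- … in particular a face one of whose sides is such a bond. [cite: KhristoforovSmirnov2021, §1.2 (loop configurations, pp. 3–4)] -/
theorem reach_of_side_eq {A : Finset (Sym2 (Site 2))} (hA : A ⊆ hBonds D) {s F'' F : HexVertex} {i i'' : Fin 3}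
    (hr : (sideGraph A).Reachable s F'') (he : side F i = side F'' i'') (hmem : side F'' i'' ∈ A) :
    (sideGraph A).Reachable s F :=
  reach_of_inc D hA hr hmem (mem_touching_of_side_mem D (j := i) (by rw [he]; exact hA hmem)) (by rw [← he]; exact inc_side F i)

/-- XOR with a set avoiding the interface faces keeps the interfaces. [cite: KhristoforovSmirnov2021, §1.2 (loop configurations, pp. 3–4)] -/
theorem ipv_symmDiff_iff (h2 : ReachXor) {j : Fin 5} {A γ : Finset (Sym2 (Site 2))} (hA : A ⊆ hBonds D)
    (hγ : ∀ e ∈ γ, ∀ F ∈ ipvSet D j A, ¬ Inc F e) (F : HexVertex) : ipv D j (symmDiff A γ) F ↔ ipv D j A F := by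
  classical
  unfold ipv
  refine exists_congr fun i => and_congr_right fun hi => ?_
  apply h2 A γ (yc D i)
  intro e he F' hF'
  apply hγ e he F'
  unfold ipvSet
  exact Finset.mem_filter.2 ⟨touching_of_reachable D hA (yc_mem_touching D i) hF', i, hi, hF'⟩

/-- Auxiliary. [cite: KhristoforovSmirnov2021, §1.2 (loop configurations, pp. 3–4)] -/
theorem ipvSet_symmDiff (h2 : ReachXor) {j : Fin 5} {A γ : Finset (Sym2 (Site 2))} (hA : A ⊆ hBonds D)
    (hγ : ∀ e ∈ γ, ∀ F ∈ ipvSet D j A, ¬ Inc F e) : ipvSet D j (symmDiff A γ) = ipvSet D j A := by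
  classical
  unfold ipvSet
  exact Finset.filter_congr fun F _ => ipv_symmDiff_iff D h2 hA hγ F

/-- Auxiliary. [cite: KhristoforovSmirnov2021, §1.2 (loop configurations, pp. 3–4)] -/
theorem patm_symmDiff_iff (h2 : ReachXor) {j : Fin 5} {m : Bool} {A γ : Finset (Sym2 (Site 2))} (hA : A ⊆ hBonds D)
    (hγ : ∀ e ∈ γ, ∀ F ∈ ipvSet D j A, ¬ Inc F e) : patm D j m (symmDiff A γ) ↔ patm D j m A := by
  classical
  unfold patm
  rw [xiLinked_iff_reachable, xiLinked_iff_reachable]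
  apply h2 A γ
  intro e he F' hF'
  apply hγ e he F'
  unfold ipvSet
  exact Finset.mem_filter.2 ⟨touching_of_reachable D hA (yc_mem_touching D (j + 1)) hF', j + 1, (fin5_add_ne j).1, hF'⟩

/-- an `A`-walk through `P`-faces is an `E`-chain through `P`-faces for `A ⊆ E`. [cite: KhristoforovSmirnov2021, §1.2 (loop configurations, pp. 3–4)] -/
theorem chain_of_reachable {A E : Finset (Sym2 (Site 2))} (hAE : A ⊆ E) {P : HexVertex → Prop} {a b : HexVertex}
    (hP : ∀ F, (sideGraph A).Reachable a F → P F) (h : (sideGraph A).Reachable a b) :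
    Relation.ReflTransGen (fun F F' => (sideGraph E).Adj F F' ∧ P F ∧ P F') a b := by
  rw [← xiLinked_iff_reachable] at h
  unfold XiLinked at h
  induction h with
  | refl => exact Relation.ReflTransGen.refl
  | @tail b' c hab hbc ih =>
    obtain ⟨i, hc, hmem⟩ := hbc
    have hb : (sideGraph A).Reachable a b' := (xiLinked_iff_reachable A _ _).1 hab
    exact ih.tail ⟨⟨i, hc, hAE hmem⟩, hP _ hb, hP _ (hb.trans ⟨SimpleGraph.Walk.cons ⟨i, hc, hmem⟩ SimpleGraph.Walk.nil⟩)⟩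

/-- Auxiliary. [cite: KhristoforovSmirnov2021, §1.2 (loop configurations, pp. 3–4)] -/
theorem mem_domD {x x' : HexVertex} {u v : Site 2} {j : Fin 5} {m : Bool} {A : Finset (Sym2 (Site 2))} :
    A ∈ domD D x x' u v j m ↔ A ⊆ (hBonds D).erase s(u, v) ∧
      (ParityIs D A (cornersNe D j) ∨ ParityIs D A (cornersNe D j ∪ {x, x'})) ∧ patm D j m A ∧
        (JoinedOff D ((hBonds D).erase s(u, v)) j A x ∨ JoinedOff D ((hBonds D).erase s(u, v)) j A x') := by
  classical
  unfold domD
  rw [Finset.mem_filter, Finset.mem_powerset]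

/-- Auxiliary. [cite: KhristoforovSmirnov2021, §1.2 (loop configurations, pp. 3–4)] -/
theorem mem_codW {x x' : HexVertex} {u v : Site 2} {j : Fin 5} {m : Bool} {A : Finset (Sym2 (Site 2))} :
    A ∈ codW D x x' u v j m ↔ A ⊆ (hBonds D).erase s(u, v) ∧
      ∃ s ∈ ({x, x'} : Finset HexVertex), ParityIs D A (insert s (corners D)) ∧ (sideGraph A).Reachable s (yc D j) ∧ patm D j m A := by
  classical
  unfold codW
  rw [Finset.mem_filter, Finset.mem_powerset]

/-- the standing facts about the inner edge `{x, x'}` and its bond `s(u, v)`. [cite: KhristoforovSmirnov2021, §1.2 (loop configurations, pp. 3–4)] -/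
theorem inner_facts {x x' : HexVertex} {u v : Site 2} (hadj : hexGraph.Adj x x') (he : faceEdge x x' = {u, v})
    (hu : u ∈ D.verts) (hv : v ∈ D.verts) :
    u ≠ v ∧ u ∈ hexFaceVertices x ∧ v ∈ hexFaceVertices x ∧ u ∈ hexFaceVertices x' ∧ v ∈ hexFaceVertices x' ∧
      x ∈ triFacesTouching D.verts ∧ x' ∈ triFacesTouching D.verts ∧ x ∉ corners D ∧ x' ∉ corners D ∧ x ≠ x' := by
  have hI : hexFaceVertices x ∩ hexFaceVertices x' = {u, v} := he
  have hux : u ∈ hexFaceVertices x := Finset.mem_of_mem_inter_left (s₂ := hexFaceVertices x') (by rw [hI]; simp)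
  have hvx : v ∈ hexFaceVertices x := Finset.mem_of_mem_inter_left (s₂ := hexFaceVertices x') (by rw [hI]; simp)
  have hux' : u ∈ hexFaceVertices x' := Finset.mem_of_mem_inter_right (s₁ := hexFaceVertices x) (by rw [hI]; simp)
  have hvx' : v ∈ hexFaceVertices x' := Finset.mem_of_mem_inter_right (s₁ := hexFaceVertices x) (by rw [hI]; simp)
  have huv : u ≠ v := by
    intro e
    have : #(faceEdge x x') = 2 := ((hexGraph_adj_iff x x').1 hadj).2
    rw [he, e] at this
    simp at this
  exact ⟨huv, hux, hvx, hux', hvx', mem_triFacesTouching.2 ⟨u, hu, hux⟩, mem_triFacesTouching.2 ⟨u, hu, hux'⟩,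
    (not_mem_corners_iff D).2 (not_corner_of_two_mem D hux hvx hu hv huv),
    (not_mem_corners_iff D).2 (not_corner_of_two_mem D hux' hvx' hu hv huv), hadj.ne⟩

open Classical in
/-- **the component of `s` in a six-odd-point configuration is a transport set** for its own interface vertex set, and it lies
off the interfaces. [cite: KhristoforovSmirnov2021, §1.2 (loop configurations, pp. 3–4)] -/
theorem comp_goodSet {x x' : HexVertex} {u v : Site 2} (hadj : hexGraph.Adj x x') (he : faceEdge x x' = {u, v})
    (hu : u ∈ D.verts) (hv : v ∈ D.verts) {j : Fin 5} {A : Finset (Sym2 (Site 2))} (hAE : A ⊆ (hBonds D).erase s(u, v))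
    {s : HexVertex} (hs : s = x ∨ s = x') (hpar : ParityIs D A (insert s (corners D))) (hsj : (sideGraph A).Reachable s (yc D j)) :
    (∀ F, (sideGraph A).Reachable s F → ¬ ipv D j A F) ∧
    GoodSet D x x' u v j (ipvSet D j A) (A.filter fun e => ∃ F, (sideGraph A).Reachable s F ∧ ∃ i : Fin 3, e = side F i) s := by
  classical
  obtain ⟨huv, hux, hvx, hux', hvx', hxT, hx'T, hxC, hx'C, hxx'⟩ := inner_facts D hadj he hu hv
  have hA : A ⊆ hBonds D := fun e he' => Finset.mem_of_mem_erase (hAE he')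
  have hsT : s ∈ triFacesTouching D.verts := by rcases hs with rfl | rfl; exacts [hxT, hx'T]
  have hsC : s ∉ corners D := by rcases hs with rfl | rfl; exacts [hxC, hx'C]
  have hdeg : ∀ F, xiDeg A F ≤ 2 := xiDeg_le_two_of_odd_imp D hadj he hu hAE fun F hF ho => by
    have := (hpar F hF).1 ho
    rw [Finset.mem_insert, mem_corners] at this
    rcases this with h | ⟨i, h⟩
    · exact Or.inr (h ▸ hs)
    · exact Or.inl ⟨i, h ▸ yc_spec D i⟩
  have hso : Odd (xiDeg A s) := (hpar s hsT).2 (Finset.mem_insert_self _ _)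
  obtain ⟨-, huniq⟩ := odd_component D hA hdeg hsT hso
  have hcodd : ∀ i, Odd (xiDeg A (yc D i)) := fun i =>
    (hpar _ (yc_mem_touching D i)).2 (Finset.mem_insert_of_mem (yc_mem_corners D i))
  have hcs : ∀ i, yc D i ≠ s := fun i h => hsC (h ▸ yc_mem_corners D i)
  have hnot_s : ¬ ipv D j A s := by
    rintro ⟨i, hi, hr⟩
    have := huniq (yc D i) (yc D j) hr.symm hsj (hcodd i) (hcodd j) (hcs i) (hcs j)
    exact hi (yc_injective D this)
  have hoff : ∀ F, (sideGraph A).Reachable s F → ¬ ipv D j A F := by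
    rintro F hF ⟨i, hi, hr⟩
    exact hnot_s ⟨i, hi, hr.trans hF.symm⟩
  refine ⟨hoff, hs, (Finset.filter_subset _ _).trans hAE, ?_, ?_⟩
  · intro e he' F hFV hinc
    obtain ⟨heA, F'', hr, i'', rfl⟩ := Finset.mem_filter.1 he'
    unfold ipvSet at hFV
    obtain ⟨hFT, hFipv⟩ := Finset.mem_filter.1 hFV
    exact hoff F (reach_of_inc D hA hr heA hFT hinc) hFipv
  · intro F hF
    by_cases hr : (sideGraph A).Reachable s F
    · have hdegF : xiDeg (A.filter fun e => ∃ F, (sideGraph A).Reachable s F ∧ ∃ i : Fin 3, e = side F i) F = xiDeg A F := by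
        unfold xiDeg
        congr 1
        refine Finset.filter_congr fun i _ => ?_
        rw [Finset.mem_filter]
        exact ⟨fun h => h.1, fun h => ⟨h, F, hr, i, rfl⟩⟩
      rw [hdegF, hpar F hF, Finset.mem_insert, mem_corners]
      constructor
      · rintro (h | ⟨i, h⟩)
        · exact Or.inr h
        · by_cases hij : i = j
          · exact Or.inl (by rw [h, hij])
          · exact absurd ⟨i, hij, by rw [h]⟩ (hoff F hr)
      · rintro (h | h)
        · exact Or.inr ⟨j, h⟩
        · exact Or.inl h
    · have h0 : xiDeg (A.filter fun e => ∃ F, (sideGraph A).Reachable s F ∧ ∃ i : Fin 3, e = side F i) F = 0 := by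
        unfold xiDeg
        rw [Finset.card_eq_zero, Finset.filter_eq_empty_iff]
        intro i _ hi
        obtain ⟨hmemA, F'', hr'', i'', he''⟩ := Finset.mem_filter.1 hi
        exact hr (reach_of_side_eq D hA hr'' he'' (he'' ▸ hmemA))
      rw [h0]
      constructor
      · intro h; exact absurd h (by decide)
      · rintro (rfl | rfl)
        · exact absurd hsj hr
        · exact absurd SimpleGraph.Reachable.rfl hr

/-- a joining chain off the interfaces yields a transport set. [cite: KhristoforovSmirnov2021, §1.2 (loop configurations, pp. 3–4)] -/
theorem goodSet_of_joined (h3 : ChainEdgeSet D) {x x' : HexVertex} {u v : Site 2} (hadj : hexGraph.Adj x x')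
    (he : faceEdge x x' = {u, v}) (hu : u ∈ D.verts) (hv : v ∈ D.verts) {j : Fin 5} {A : Finset (Sym2 (Site 2))}
    {t₀ : HexVertex} (ht₀ : t₀ = x ∨ t₀ = x') (hJ : JoinedOff D ((hBonds D).erase s(u, v)) j A t₀) :
    ∃ γ t, GoodSet D x x' u v j (ipvSet D j A) γ t := by
  classical
  obtain ⟨-, -, -, -, -, -, -, hxC, hx'C, -⟩ := inner_facts D hadj he hu hv
  obtain ⟨-, -, hchain⟩ := hJ
  obtain ⟨γ, hγE, havoid, hpar⟩ := h3 _ (Finset.erase_subset _ _) (fun F => ¬ ipv D j A F) (yc D j) t₀ hchain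
  have ht₀C : t₀ ∉ corners D := by rcases ht₀ with rfl | rfl; exacts [hxC, hx'C]
  have hne : yc D j ≠ t₀ := fun h => ht₀C (h ▸ yc_mem_corners D j)
  refine ⟨γ, t₀, ht₀, hγE, fun e he' F hFV hinc => ?_, fun F hF => ?_⟩
  · unfold ipvSet at hFV
    obtain ⟨hFT, hFipv⟩ := Finset.mem_filter.1 hFV
    exact havoid e he' F hFT hinc hFipv
  · rw [hpar F hF]
    unfold Xor
    constructor
    · rintro (⟨h, -⟩ | ⟨h, -⟩)
      · exact Or.inl h
      · exact Or.inr h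
    · rintro (h | h)
      · exact Or.inl ⟨h, fun h' => hne (h.symm.trans h')⟩
      · exact Or.inr ⟨h, fun h' => hne (h'.symm.trans h)⟩

/-- **N3-A from (L1)–(L3)**: `#domD = #codW`, by the involution `Φ`. [cite: KhristoforovSmirnov2021, §1.2 (loop configurations, pp. 3–4)] -/
theorem transportCore_of (h1 : XorDeg) (h2 : ReachXor) (h3 : ChainEdgeSet D) : TransportCore D := by
  classical
  intro x x' u v hx hadj he hu hv j m
  obtain ⟨huv, hux, hvx, hux', hvx', hxT, hx'T, hxC, hx'C, hxx'⟩ := inner_facts D hadj he hu hv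
  have hE₀B : (hBonds D).erase s(u, v) ⊆ hBonds D := Finset.erase_subset _ _
  -- Φ maps domD into codW and keeps the interface vertex set
  have hDW : ∀ A ∈ domD D x x' u v j m,
      Phi D x x' u v j A ∈ codW D x x' u v j m ∧ ipvSet D j (Phi D x x' u v j A) = ipvSet D j A := by
    intro A hA
    obtain ⟨hAE, hparA, hpat, hJ⟩ := (mem_domD D).1 hA
    have hAB : A ⊆ hBonds D := hAE.trans hE₀B
    have hex : ∃ γ t, GoodSet D x x' u v j (ipvSet D j A) γ t := by
      rcases hJ with hJ | hJ
      · exact goodSet_of_joined D h3 hadj he hu hv (Or.inl rfl) hJ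
      · exact goodSet_of_joined D h3 hadj he hu hv (Or.inr rfl) hJ
    obtain ⟨t, htx, hγE, havoid, hγpar⟩ := gam_good D hex
    set γ := gam D x x' u v j (ipvSet D j A) with hγ
    have hipv : ∀ F, ipv D j (symmDiff A γ) F ↔ ipv D j A F := ipv_symmDiff_iff D h2 hAB havoid
    have hipvSet : ipvSet D j (symmDiff A γ) = ipvSet D j A := ipvSet_symmDiff D h2 hAB havoid
    have hPhi : Phi D x x' u v j A = symmDiff A γ := rfl
    rw [hPhi]
    refine ⟨?_, hipvSet⟩
    have htC : t ∉ corners D := by rcases htx with rfl | rfl; exacts [hxC, hx'C]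
    have htT : t ∈ triFacesTouching D.verts := by rcases htx with rfl | rfl; exacts [hxT, hx'T]
    -- t is off the interfaces (γ has a side of t)
    have ht_odd : Odd (xiDeg γ t) := (hγpar t htT).2 (Or.inr rfl)
    have ht_nipv : ¬ ipv D j A t := by
      intro hti
      have hpos : 0 < xiDeg γ t := Nat.pos_of_ne_zero fun h0 => by
        rw [h0] at ht_odd; exact absurd ht_odd (by decide)
      unfold xiDeg at hpos
      obtain ⟨i, hi⟩ := Finset.card_pos.1 hpos
      have hside : side t i ∈ γ := (Finset.mem_filter.1 hi).2
      exact havoid _ hside t (by unfold ipvSet; exact Finset.mem_filter.2 ⟨htT, hti⟩) (inc_side t i)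
    have hsub' : symmDiff A γ ⊆ (hBonds D).erase s(u, v) := fun e he' => by
      rcases Finset.mem_symmDiff.1 he' with ⟨h, -⟩ | ⟨h, -⟩
      · exact hAE h
      · exact hγE h
    have hparity : ∀ F ∈ triFacesTouching D.verts,
        (Odd (xiDeg (symmDiff A γ) F) ↔ ¬ (Odd (xiDeg A F) ↔ (F = yc D j ∨ F = t))) := by
      intro F hF
      rw [h1 A γ F, hγpar F hF]
    -- the new odd vertex s'
    obtain ⟨s', hs'x, hs'par, hs'nipv⟩ : ∃ s', (s' = x ∨ s' = x') ∧ ParityIs D (symmDiff A γ) (insert s' (corners D)) ∧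
        ¬ ipv D j A s' := by
      rcases hparA with hP | hP
      · refine ⟨t, htx, fun F hF => ?_, ht_nipv⟩
        rw [hparity F hF, hP F hF]
        exact parity_shift₁ D j htC F
      · obtain ⟨t', ht'x, htt', hpair⟩ : ∃ t', (t' = x ∨ t' = x') ∧ t ≠ t' ∧ ({x, x'} : Finset HexVertex) = {t, t'} := by
          rcases htx with rfl | rfl
          · exact ⟨x', Or.inr rfl, hxx', rfl⟩
          · exact ⟨x, Or.inl rfl, fun h => hxx' h.symm, Finset.pair_comm _ _⟩
        have ht'C : t' ∉ corners D := by rcases ht'x with rfl | rfl; exacts [hxC, hx'C]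
        refine ⟨t', ht'x, fun F hF => ?_, ?_⟩
        · rw [hparity F hF, hP F hF, hpair]
          exact parity_shift₂ D j htC ht'C htt' F
        · intro ht'i
          have hdegA : ∀ F, xiDeg A F ≤ 2 := xiDeg_le_two_of_odd_imp D hadj he hu hAE fun F hF ho => by
            have := (hP F hF).1 ho
            rw [Finset.mem_union, mem_cornersNe, Finset.mem_insert, Finset.mem_singleton] at this
            rcases this with ⟨i, -, h⟩ | h
            · exact Or.inl ⟨i, h ▸ yc_spec D i⟩
            · exact Or.inr h
          have htoddA : Odd (xiDeg A t) := (hP t htT).2 (Finset.mem_union_right _ (by rw [hpair]; simp))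
          obtain ⟨⟨Z, hZt, hZodd, hZr⟩, -⟩ := odd_component D hAB hdegA htT htoddA
          have hZT := touching_of_reachable D hAB htT hZr
          have hZ := (hP Z hZT).1 hZodd
          rw [hpair, Finset.mem_union, mem_cornersNe, Finset.mem_insert, Finset.mem_singleton] at hZ
          rcases hZ with ⟨i, hi, hZi⟩ | hZ' | hZ'
          · exact ht_nipv ⟨i, hi, (hZi ▸ hZr).symm⟩
          · exact hZt hZ'
          · obtain ⟨i, hi, hr⟩ := ht'i
            exact ht_nipv ⟨i, hi, (hr.trans (hZ' ▸ hZr).symm)⟩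
    -- s' is linked to y_j in A ∆ γ
    have hs'T : s' ∈ triFacesTouching D.verts := by rcases hs'x with rfl | rfl; exacts [hxT, hx'T]
    have hdeg' : ∀ F, xiDeg (symmDiff A γ) F ≤ 2 := xiDeg_le_two_of_odd_imp D hadj he hu hsub' fun F hF ho => by
      have := (hs'par F hF).1 ho
      rw [Finset.mem_insert, mem_corners] at this
      rcases this with h | ⟨i, h⟩
      · exact Or.inr (h ▸ hs'x)
      · exact Or.inl ⟨i, h ▸ yc_spec D i⟩
    have hs'odd : Odd (xiDeg (symmDiff A γ) s') := (hs'par s' hs'T).2 (Finset.mem_insert_self _ _)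
    obtain ⟨⟨Z, hZs, hZodd, hZr⟩, -⟩ := odd_component D (hsub'.trans hE₀B) hdeg' hs'T hs'odd
    have hZT := touching_of_reachable D (hsub'.trans hE₀B) hs'T hZr
    have hZ := (hs'par Z hZT).1 hZodd
    rw [Finset.mem_insert, mem_corners] at hZ
    have hreach : (sideGraph (symmDiff A γ)).Reachable s' (yc D j) := by
      rcases hZ with h | ⟨i, hZi⟩
      · exact absurd h hZs
      · by_cases hij : i = j
        · rw [← hij, ← hZi]; exact hZr
        · exact absurd ((hipv s').1 ⟨i, hij, (hZi ▸ hZr).symm⟩) hs'nipv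
    refine (mem_codW D).2 ⟨hsub', s', ?_, hs'par, hreach, (patm_symmDiff_iff D h2 hAB havoid).2 hpat⟩
    rcases hs'x with rfl | rfl <;> simp
  -- Φ maps codW into domD and keeps the interface vertex set
  have hWD : ∀ A ∈ codW D x x' u v j m,
      Phi D x x' u v j A ∈ domD D x x' u v j m ∧ ipvSet D j (Phi D x x' u v j A) = ipvSet D j A := by
    intro A hA
    obtain ⟨hAE, s, hs, hparA, hsj, hpat⟩ := (mem_codW D).1 hA
    have hAB : A ⊆ hBonds D := hAE.trans hE₀B
    have hs' : s = x ∨ s = x' := by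
      rcases Finset.mem_insert.1 hs with h | h
      · exact Or.inl h
      · exact Or.inr (Finset.mem_singleton.1 h)
    obtain ⟨hoff, hgood⟩ := comp_goodSet D hadj he hu hv hAE hs' hparA hsj
    obtain ⟨t, htx, hγE, havoid, hγpar⟩ := gam_good D ⟨_, _, hgood⟩
    set γ := gam D x x' u v j (ipvSet D j A) with hγ
    have hipv : ∀ F, ipv D j (symmDiff A γ) F ↔ ipv D j A F := ipv_symmDiff_iff D h2 hAB havoid
    have hipvSet : ipvSet D j (symmDiff A γ) = ipvSet D j A := ipvSet_symmDiff D h2 hAB havoid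
    have hPhi : Phi D x x' u v j A = symmDiff A γ := rfl
    rw [hPhi]
    refine ⟨?_, hipvSet⟩
    have htC : t ∉ corners D := by rcases htx with rfl | rfl; exacts [hxC, hx'C]
    have hsC : s ∉ corners D := by rcases hs' with rfl | rfl; exacts [hxC, hx'C]
    have hsub' : symmDiff A γ ⊆ (hBonds D).erase s(u, v) := fun e he' => by
      rcases Finset.mem_symmDiff.1 he' with ⟨h, -⟩ | ⟨h, -⟩
      · exact hAE h
      · exact hγE h
    have hparity : ∀ F ∈ triFacesTouching D.verts,
        (Odd (xiDeg (symmDiff A γ) F) ↔ ¬ ((F ∈ insert s (corners D)) ↔ (F = yc D j ∨ F = t))) := by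
      intro F hF
      rw [h1 A γ F, hγpar F hF, hparA F hF]
    refine (mem_domD D).2 ⟨hsub', ?_, (patm_symmDiff_iff D h2 hAB havoid).2 hpat, ?_⟩
    · by_cases hts : t = s
      · left
        intro F hF
        rw [hparity F hF, ← hts]
        exact xor_swap (parity_shift₁ D j htC F)
      · right
        intro F hF
        rw [hparity F hF]
        have hpair : ({x, x'} : Finset HexVertex) = {t, s} := by
          rcases htx with htx | htx <;> rcases hs' with hs' | hs'
          · exact absurd (htx.trans hs'.symm) hts
          · rw [htx, hs']
          · rw [htx, hs', Finset.pair_comm]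
          · exact absurd (htx.trans hs'.symm) hts
        rw [hpair]
        exact xor_swap (parity_shift₂ D j htC hsC hts F)
    · have hJ : JoinedOff D ((hBonds D).erase s(u, v)) j (symmDiff A γ) s := by
        refine ⟨fun h => hoff s SimpleGraph.Reachable.rfl ((hipv s).1 h), fun h => hoff _ hsj ((hipv _).1 h), ?_⟩
        exact chain_of_reachable (E := (hBonds D).erase s(u, v)) hAE (P := fun F => ¬ ipv D j (symmDiff A γ) F)
          (a := yc D j) (b := s) (fun F hF => fun h => hoff F (hsj.trans hF) ((hipv F).1 h)) hsj.symm
      rcases hs' with rfl | rfl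
      · exact Or.inl hJ
      · exact Or.inr hJ
  -- Φ is an involution on both sides
  have hinv : ∀ A, ipvSet D j (Phi D x x' u v j A) = ipvSet D j A → Phi D x x' u v j (Phi D x x' u v j A) = A := by
    intro A h
    show symmDiff (Phi D x x' u v j A) (gam D x x' u v j (ipvSet D j (Phi D x x' u v j A))) = A
    rw [h]
    exact symmDiff_symmDiff_cancel_right _ _
  exact Finset.card_bij' (fun A _ => Phi D x x' u v j A) (fun A _ => Phi D x x' u v j A) (fun A hA => (hDW A hA).1)
    (fun A hA => (hWD A hA).1) (fun A hA => hinv A (hDW A hA).2) (fun A hA => hinv A (hWD A hA).2)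

/-! #### N3-B2: erasing the inner bond `b₀` (`domR ≃ domD`) — proved modulo (L1), (L2) -/

/-- the touching faces having `b₀` as a side are `x` and `x'`. [cite: KhristoforovSmirnov2021, §1.2 (loop configurations, pp. 3–4)] -/
theorem side_eq_b0_iff {x x' : HexVertex} {u v : Site 2} (hadj : hexGraph.Adj x x') (he : faceEdge x x' = {u, v})
    (hu : u ∈ D.verts) (hv : v ∈ D.verts) {F : HexVertex} (hF : F ∈ triFacesTouching D.verts) :
    (∃ i : Fin 3, side F i = s(u, v)) ↔ (F = x ∨ F = x') := by
  obtain ⟨huv, hux, hvx, hux', hvx', -, -, -, -, -⟩ := inner_facts D hadj he hu hv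
  have huvadj : triGraph.Adj u v := adj_of_mem_hexFaceVertices hux hvx huv
  have hbB : s(u, v) ∈ hBonds D := mem_hBonds D huvadj (Or.inl hu)
  constructor
  · rintro ⟨i, hi⟩
    exact eq_or_eq_of_inc D hadj he hu hF (by rw [← hi]; exact inc_side F i)
  · intro hF'
    have hinc : Inc F s(u, v) := by
      rcases hF' with rfl | rfl
      · exact inc_mk_iff.2 ⟨hux, hvx⟩
      · exact inc_mk_iff.2 ⟨hux', hvx'⟩
    obtain ⟨i, hi⟩ := exists_side_eq_of_inc D hbB hinc
    exact ⟨i, hi.symm⟩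

/-- the singleton `{b₀}` is odd exactly at `x` and `x'`. [cite: KhristoforovSmirnov2021, §1.2 (loop configurations, pp. 3–4)] -/
theorem odd_xiDeg_singleton_iff {x x' : HexVertex} {u v : Site 2} (hadj : hexGraph.Adj x x') (he : faceEdge x x' = {u, v})
    (hu : u ∈ D.verts) (hv : v ∈ D.verts) {F : HexVertex} (hF : F ∈ triFacesTouching D.verts) :
    Odd (xiDeg {s(u, v)} F) ↔ (F = x ∨ F = x') := by
  classical
  rw [← side_eq_b0_iff D hadj he hu hv hF]
  unfold xiDeg
  constructor
  · intro ho
    have hpos : 0 < #((Finset.univ : Finset (Fin 3)).filter fun j =>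
        s(faceVertex F (j + 1), faceVertex F (j + 2)) ∈ ({s(u, v)} : Finset (Sym2 (Site 2)))) := by
      rcases Nat.eq_zero_or_pos (#((Finset.univ : Finset (Fin 3)).filter fun j =>
        s(faceVertex F (j + 1), faceVertex F (j + 2)) ∈ ({s(u, v)} : Finset (Sym2 (Site 2))))) with h0 | hpos
      · rw [h0] at ho; exact absurd ho (by decide)
      · exact hpos
    obtain ⟨i, hi⟩ := Finset.card_pos.1 hpos
    exact ⟨i, Finset.mem_singleton.1 (Finset.mem_filter.1 hi).2⟩
  · rintro ⟨i, hi⟩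
    have hset : ((Finset.univ : Finset (Fin 3)).filter fun j =>
        s(faceVertex F (j + 1), faceVertex F (j + 2)) ∈ ({s(u, v)} : Finset (Sym2 (Site 2)))) = {i} := by
      ext j
      simp only [Finset.mem_filter, Finset.mem_univ, true_and, Finset.mem_singleton]
      constructor
      · intro hj
        apply side_injective F
        rw [hi]
        exact hj
      · intro hj
        rw [hj]
        exact hi
    rw [hset, Finset.card_singleton]
    exact odd_one

/-- Auxiliary. [cite: KhristoforovSmirnov2021, §1.2 (loop configurations, pp. 3–4)] -/
theorem erase_eq_symmDiff {B : Finset (Sym2 (Site 2))} {b : Sym2 (Site 2)} (hb : b ∈ B) : B.erase b = symmDiff B {b} := by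
  ext e
  rw [Finset.mem_erase, Finset.mem_symmDiff, Finset.mem_singleton]
  constructor
  · rintro ⟨hne, he⟩; exact Or.inl ⟨he, hne⟩
  · rintro (⟨he, hne⟩ | ⟨rfl, hnb⟩)
    · exact ⟨hne, he⟩
    · exact absurd hb hnb

/-- Auxiliary. [cite: KhristoforovSmirnov2021, §1.2 (loop configurations, pp. 3–4)] -/
theorem insert_eq_symmDiff {A : Finset (Sym2 (Site 2))} {b : Sym2 (Site 2)} (hb : b ∉ A) : insert b A = symmDiff A {b} := by
  ext e
  rw [Finset.mem_insert, Finset.mem_symmDiff, Finset.mem_singleton]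
  constructor
  · rintro (rfl | he)
    · exact Or.inr ⟨rfl, hb⟩
    · exact Or.inl ⟨he, fun h => hb (h ▸ he)⟩
  · rintro (⟨he, -⟩ | ⟨rfl, -⟩)
    · exact Or.inr he
    · exact Or.inl rfl

/-- `{b₀}` avoids the interface faces when `x, x'` are off the interfaces. [cite: KhristoforovSmirnov2021, §1.2 (loop configurations, pp. 3–4)] -/
theorem b0_avoids {x x' : HexVertex} {u v : Site 2} (hadj : hexGraph.Adj x x') (he : faceEdge x x' = {u, v})
    (hu : u ∈ D.verts) {j : Fin 5} {B : Finset (Sym2 (Site 2))} (hx : ¬ ipv D j B x) (hx' : ¬ ipv D j B x') :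
    ∀ e ∈ ({s(u, v)} : Finset (Sym2 (Site 2))), ∀ F ∈ ipvSet D j B, ¬ Inc F e := by
  classical
  intro e he' F hF hinc
  rw [Finset.mem_singleton] at he'
  subst he'
  unfold ipvSet at hF
  obtain ⟨hFT, hFi⟩ := Finset.mem_filter.1 hF
  rcases eq_or_eq_of_inc D hadj he hu hFT hinc with rfl | rfl
  · exact hx hFi
  · exact hx' hFi

/-- with odd set `{y_i : i ≠ j} ∪ {x, x'}`: if one of `x, x'` is off the interfaces, both are (they end one path). [cite: KhristoforovSmirnov2021, §1.2 (loop configurations, pp. 3–4)] -/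
theorem other_end_nipv {x x' : HexVertex} {u v : Site 2} (hadj : hexGraph.Adj x x') (he : faceEdge x x' = {u, v})
    (hu : u ∈ D.verts) (hv : v ∈ D.verts) {j : Fin 5} {A : Finset (Sym2 (Site 2))} (hAE : A ⊆ (hBonds D).erase s(u, v))
    (hP : ParityIs D A (cornersNe D j ∪ {x, x'})) {t : HexVertex} (htx : t = x ∨ t = x') (ht : ¬ ipv D j A t) :
    ¬ ipv D j A x ∧ ¬ ipv D j A x' := by
  classical
  obtain ⟨-, -, -, -, -, hxT, hx'T, -, -, -⟩ := inner_facts D hadj he hu hv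
  have hAB : A ⊆ hBonds D := hAE.trans (Finset.erase_subset _ _)
  have htT : t ∈ triFacesTouching D.verts := by rcases htx with rfl | rfl; exacts [hxT, hx'T]
  have hdegA : ∀ F, xiDeg A F ≤ 2 := xiDeg_le_two_of_odd_imp D hadj he hu hAE fun F hF ho => by
    have := (hP F hF).1 ho
    rw [Finset.mem_union, mem_cornersNe, Finset.mem_insert, Finset.mem_singleton] at this
    rcases this with ⟨i, -, h⟩ | h
    · exact Or.inl ⟨i, h ▸ yc_spec D i⟩
    · exact Or.inr h
  have htoddA : Odd (xiDeg A t) := (hP t htT).2 (Finset.mem_union_right _ (by rcases htx with rfl | rfl <;> simp))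
  obtain ⟨⟨Z, hZt, hZodd, hZr⟩, -⟩ := odd_component D hAB hdegA htT htoddA
  have hZT := touching_of_reachable D hAB htT hZr
  have hZ := (hP Z hZT).1 hZodd
  rw [Finset.mem_union, mem_cornersNe, Finset.mem_insert, Finset.mem_singleton] at hZ
  have hZnipv : ¬ ipv D j A Z := fun ⟨i, hi, hr⟩ => ht ⟨i, hi, hr.trans hZr.symm⟩
  rcases hZ with ⟨i, hi, hZi⟩ | hZx | hZx'
  · exact absurd ⟨i, hi, (hZi ▸ hZr).symm⟩ ht
  · rcases htx with rfl | rfl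
    · exact absurd hZx hZt
    · exact ⟨hZx ▸ hZnipv, ht⟩
  · rcases htx with rfl | rfl
    · exact ⟨ht, hZx' ▸ hZnipv⟩
    · exact absurd hZx' hZt

/-- **cutting a joining chain at the edge `{x, x'}`**: an `H_G`-chain through `P`-faces either avoids `b₀`, or both `x, x'` are
`P`-faces and an initial segment avoiding `b₀` reaches one of them. [cite: KhristoforovSmirnov2021, §1.2 (loop configurations, pp. 3–4)] -/
theorem chain_split {x x' : HexVertex} {u v : Site 2} (hadj : hexGraph.Adj x x') (he : faceEdge x x' = {u, v})
    (hu : u ∈ D.verts) (hv : v ∈ D.verts) (P : HexVertex → Prop) {a t : HexVertex}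
    (h : Relation.ReflTransGen (fun F F' => (sideGraph (hBonds D)).Adj F F' ∧ P F ∧ P F') a t) :
    Relation.ReflTransGen (fun F F' => (sideGraph ((hBonds D).erase s(u, v))).Adj F F' ∧ P F ∧ P F') a t ∨
    (P x ∧ P x' ∧
      (Relation.ReflTransGen (fun F F' => (sideGraph ((hBonds D).erase s(u, v))).Adj F F' ∧ P F ∧ P F') a x ∨
        Relation.ReflTransGen (fun F F' => (sideGraph ((hBonds D).erase s(u, v))).Adj F F' ∧ P F ∧ P F') a x')) := by
  induction h using Relation.ReflTransGen.head_induction_on with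
  | refl => exact Or.inl Relation.ReflTransGen.refl
  | @head a' b' hab _ ih =>
    obtain ⟨⟨i, hb, hside⟩, hPa, hPb⟩ := hab
    by_cases hbi : side a' i = s(u, v)
    · right
      have haT : a' ∈ triFacesTouching D.verts := mem_touching_of_side_mem D hside
      have ha := (side_eq_b0_iff D hadj he hu hv haT).1 ⟨i, hbi⟩
      have hbT : oppFace a' i ∈ triFacesTouching D.verts :=
        mem_touching_of_side_mem D (j := oppIdx a' i) (by rw [side_oppFace_oppIdx]; exact hside)
      have hb' := (side_eq_b0_iff D hadj he hu hv hbT).1 ⟨oppIdx a' i, by rw [side_oppFace_oppIdx]; exact hbi⟩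
      have hne : a' ≠ oppFace a' i := (hexGraph_adj_oppFace a' i).ne
      rw [← hb] at hb' hne
      rcases ha with rfl | rfl <;> rcases hb' with rfl | rfl
      · exact absurd rfl hne
      · exact ⟨hPa, hPb, Or.inl Relation.ReflTransGen.refl⟩
      · exact ⟨hPb, hPa, Or.inr Relation.ReflTransGen.refl⟩
      · exact absurd rfl hne
    · have hstep : (sideGraph ((hBonds D).erase s(u, v))).Adj a' b' ∧ P a' ∧ P b' :=
        ⟨⟨i, hb, Finset.mem_erase.2 ⟨hbi, hside⟩⟩, hPa, hPb⟩
      rcases ih with h | ⟨hx, hx', h | h⟩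
      · exact Or.inl (Relation.ReflTransGen.head hstep h)
      · exact Or.inr ⟨hx, hx', Or.inl (Relation.ReflTransGen.head hstep h)⟩
      · exact Or.inr ⟨hx, hx', Or.inr (Relation.ReflTransGen.head hstep h)⟩

/-- Auxiliary. [cite: KhristoforovSmirnov2021, §1.2 (loop configurations, pp. 3–4)] -/
theorem xor_or_iff {a q : Prop} (h : q → ¬ a) : (¬ (a ↔ q) ↔ (a ∨ q)) := by tauto

/-- Auxiliary. [cite: KhristoforovSmirnov2021, §1.2 (loop configurations, pp. 3–4)] -/
theorem xor_or_iff' {a q : Prop} (h : q → ¬ a) : (¬ ((a ∨ q) ↔ q) ↔ a) := by tauto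

/-- **N3-B2 from (L1), (L2)**: `#domR = #domD` via `B ↦ B.erase b₀`. [cite: KhristoforovSmirnov2021, §1.2 (loop configurations, pp. 3–4)] -/
theorem transportErase_of (h1 : XorDeg) (h2 : ReachXor) : TransportErase D := by
  classical
  intro x x' u v _hx hadj he hu hv j m
  obtain ⟨huv, hux, hvx, hux', hvx', hxT, hx'T, hxC, hx'C, hxx'⟩ := inner_facts D hadj he hu hv
  have hE₀B : (hBonds D).erase s(u, v) ⊆ hBonds D := Finset.erase_subset _ _
  have huvadj : triGraph.Adj u v := adj_of_mem_hexFaceVertices hux hvx huv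
  have hbB : s(u, v) ∈ hBonds D := mem_hBonds D huvadj (Or.inl hu)
  have hxCj : x ∉ cornersNe D j := fun h => hxC (cornersNe_subset_corners D j h)
  have hx'Cj : x' ∉ cornersNe D j := fun h => hx'C (cornersNe_subset_corners D j h)
  -- loopSpace membership as a parity profile
  have hLS : ∀ B, B ∈ loopSpace D j ↔ B ⊆ hBonds D ∧ ParityIs D B (cornersNe D j) := by
    intro B
    unfold loopSpace ParityIs
    rw [Finset.mem_filter, Finset.mem_powerset]
    refine and_congr_right fun _ => forall₂_congr fun F _ => ?_
    rw [mem_cornersNe]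
    exact iff_congr Iff.rfl (exists_congr fun i => and_congr_right fun _ => isCornerFace_iff_eq_yc D)
  have hmemR : ∀ B, B ∈ domR D x x' j m ↔ (B ⊆ hBonds D ∧ ParityIs D B (cornersNe D j)) ∧ patm D j m B ∧
      (JoinedOff D (hBonds D) j B x ∨ JoinedOff D (hBonds D) j B x') := by
    intro B
    unfold domR
    rw [Finset.mem_filter, hLS]
  -- parity after toggling b₀
  have htoggle : ∀ (B : Finset (Sym2 (Site 2))) (F : HexVertex), F ∈ triFacesTouching D.verts →
      (Odd (xiDeg (symmDiff B {s(u, v)}) F) ↔ ¬ (Odd (xiDeg B F) ↔ (F = x ∨ F = x'))) := by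
    intro B F hF
    rw [h1 B {s(u, v)} F, odd_xiDeg_singleton_iff D hadj he hu hv hF]
  -- E₀-chains are hBonds-chains
  have hmono : ∀ (P : HexVertex → Prop) (a b : HexVertex),
      Relation.ReflTransGen (fun F F' => (sideGraph ((hBonds D).erase s(u, v))).Adj F F' ∧ P F ∧ P F') a b →
      Relation.ReflTransGen (fun F F' => (sideGraph (hBonds D)).Adj F F' ∧ P F ∧ P F') a b := by
    intro P a b h
    induction h with
    | refl => exact Relation.ReflTransGen.refl
    | tail _ hbc ih =>
      obtain ⟨⟨i, hc, hmem⟩, hP1, hP2⟩ := hbc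
      exact ih.tail ⟨⟨i, hc, hE₀B hmem⟩, hP1, hP2⟩
  refine Finset.card_bij (fun B _ => B.erase s(u, v)) (fun B hB => ?_) (fun B₁ hB₁ B₂ hB₂ hEq => ?_) (fun A hA => ?_)
  · -- maps into domD
    obtain ⟨⟨hBB, hparB⟩, hpat, hJ⟩ := (hmemR B).1 hB
    have hoffb : s(u, v) ∈ B → ¬ ipv D j B x ∧ ¬ ipv D j B x' := by
      intro hb
      have hadjB : (sideGraph B).Adj x x' := by
        obtain ⟨i, hi⟩ := (side_eq_b0_iff D hadj he hu hv hxT).2 (Or.inl rfl)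
        have hoT : oppFace x i ∈ triFacesTouching D.verts :=
          mem_touching_of_side_mem D (j := oppIdx x i) (by rw [side_oppFace_oppIdx, hi]; exact hbB)
        rcases (side_eq_b0_iff D hadj he hu hv hoT).1 ⟨oppIdx x i, by rw [side_oppFace_oppIdx, hi]⟩ with h | h
        · exact absurd h.symm (hexGraph_adj_oppFace x i).ne
        · exact ⟨i, h.symm, by rw [hi]; exact hb⟩
      rcases hJ with hJ | hJ
      · have hx1 := hJ.1
        exact ⟨hx1, fun h => hx1 (by obtain ⟨i', hi', hr⟩ := h; exact ⟨i', hi', hr.trans hadjB.symm.reachable⟩)⟩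
      · have hx1 := hJ.1
        exact ⟨fun h => hx1 (by obtain ⟨i', hi', hr⟩ := h; exact ⟨i', hi', hr.trans hadjB.reachable⟩), hx1⟩
    have hipv : ∀ F, ipv D j (B.erase s(u, v)) F ↔ ipv D j B F := by
      by_cases hb : s(u, v) ∈ B
      · rw [erase_eq_symmDiff hb]
        obtain ⟨h0, h0'⟩ := hoffb hb
        exact ipv_symmDiff_iff D h2 hBB (b0_avoids D hadj he hu h0 h0')
      · rw [Finset.erase_eq_of_notMem hb]
        exact fun F => Iff.rfl
    have hpat' : patm D j m (B.erase s(u, v)) := by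
      by_cases hb : s(u, v) ∈ B
      · rw [erase_eq_symmDiff hb]
        obtain ⟨h0, h0'⟩ := hoffb hb
        exact (patm_symmDiff_iff D h2 hBB (b0_avoids D hadj he hu h0 h0')).2 hpat
      · rw [Finset.erase_eq_of_notMem hb]
        exact hpat
    have hpar' : ParityIs D (B.erase s(u, v)) (cornersNe D j) ∨ ParityIs D (B.erase s(u, v)) (cornersNe D j ∪ {x, x'}) := by
      by_cases hb : s(u, v) ∈ B
      · right
        intro F hF
        rw [erase_eq_symmDiff hb, htoggle B F hF, hparB F hF, Finset.mem_union, Finset.mem_insert, Finset.mem_singleton]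
        have : (F = x ∨ F = x') → F ∉ cornersNe D j := by rintro (rfl | rfl); exacts [hxCj, hx'Cj]
        exact xor_or_iff this
      · left
        rw [Finset.erase_eq_of_notMem hb]
        exact hparB
    have hrel : (fun F F' => (sideGraph ((hBonds D).erase s(u, v))).Adj F F' ∧ ¬ ipv D j (B.erase s(u, v)) F ∧
          ¬ ipv D j (B.erase s(u, v)) F') =
        (fun F F' => (sideGraph ((hBonds D).erase s(u, v))).Adj F F' ∧ ¬ ipv D j B F ∧ ¬ ipv D j B F') := by
      funext F F'
      rw [hipv, hipv]
    have hJ' : JoinedOff D ((hBonds D).erase s(u, v)) j (B.erase s(u, v)) x ∨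
        JoinedOff D ((hBonds D).erase s(u, v)) j (B.erase s(u, v)) x' := by
      unfold JoinedOff
      rw [hrel, hipv x, hipv x', hipv (yc D j)]
      have key : ∀ t, (t = x ∨ t = x') → JoinedOff D (hBonds D) j B t →
          (¬ ipv D j B x ∧ ¬ ipv D j B (yc D j) ∧ Relation.ReflTransGen
              (fun F F' => (sideGraph ((hBonds D).erase s(u, v))).Adj F F' ∧ ¬ ipv D j B F ∧ ¬ ipv D j B F') (yc D j) x) ∨
          (¬ ipv D j B x' ∧ ¬ ipv D j B (yc D j) ∧ Relation.ReflTransGen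
              (fun F F' => (sideGraph ((hBonds D).erase s(u, v))).Adj F F' ∧ ¬ ipv D j B F ∧ ¬ ipv D j B F') (yc D j) x') := by
        rintro t ht ⟨hnt, hnj, hchain⟩
        rcases chain_split D hadj he hu hv (fun F => ¬ ipv D j B F) hchain with h | ⟨hPx, hPx', h | h⟩
        · rcases ht with rfl | rfl
          · exact Or.inl ⟨hnt, hnj, h⟩
          · exact Or.inr ⟨hnt, hnj, h⟩
        · exact Or.inl ⟨hPx, hnj, h⟩
        · exact Or.inr ⟨hPx', hnj, h⟩
      rcases hJ with hJ | hJ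
      · exact key x (Or.inl rfl) hJ
      · exact key x' (Or.inr rfl) hJ
    exact (mem_domD D).2 ⟨Finset.erase_subset_erase _ hBB, hpar', hpat', hJ'⟩
  · -- injective
    obtain ⟨⟨hB₁s, hpar₁⟩, -, -⟩ := (hmemR B₁).1 hB₁
    obtain ⟨⟨hB₂s, hpar₂⟩, -, -⟩ := (hmemR B₂).1 hB₂
    have key : ∀ B B' : Finset (Sym2 (Site 2)), ParityIs D B (cornersNe D j) → ParityIs D B' (cornersNe D j) →
        B.erase s(u, v) = B'.erase s(u, v) → s(u, v) ∈ B → s(u, v) ∈ B' := by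
      intro B B' hP hP' hEq' hb
      by_contra hb'
      have h1' : Odd (xiDeg (symmDiff B {s(u, v)}) x) := by
        rw [htoggle B x hxT, hP x hxT]
        intro h
        exact hxCj (h.2 (Or.inl rfl))
      rw [← erase_eq_symmDiff hb, hEq', Finset.erase_eq_of_notMem hb', hP' x hxT] at h1'
      exact hxCj h1'
    have hiff : s(u, v) ∈ B₁ ↔ s(u, v) ∈ B₂ := ⟨key B₁ B₂ hpar₁ hpar₂ hEq, key B₂ B₁ hpar₂ hpar₁ hEq.symm⟩
    have hEq' : B₁.erase s(u, v) = B₂.erase s(u, v) := hEq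
    by_cases hb : s(u, v) ∈ B₁
    · rw [← Finset.insert_erase hb, ← Finset.insert_erase (hiff.1 hb), hEq']
    · rw [← Finset.erase_eq_of_notMem hb, ← Finset.erase_eq_of_notMem (fun h => hb (hiff.2 h)), hEq']
  · -- surjective
    obtain ⟨hAE, hparA, hpat, hJ⟩ := (mem_domD D).1 hA
    have hAB : A ⊆ hBonds D := hAE.trans hE₀B
    have hbA : s(u, v) ∉ A := fun h => (Finset.mem_erase.1 (hAE h)).1 rfl
    rcases hparA with hP | hP
    · refine ⟨A, (hmemR A).2 ⟨⟨hAB, hP⟩, hpat, ?_⟩, Finset.erase_eq_of_notMem hbA⟩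
      rcases hJ with ⟨h1', h2', h3'⟩ | ⟨h1', h2', h3'⟩
      · exact Or.inl ⟨h1', h2', hmono _ _ _ h3'⟩
      · exact Or.inr ⟨h1', h2', hmono _ _ _ h3'⟩
    · have hoff : ¬ ipv D j A x ∧ ¬ ipv D j A x' := by
        rcases hJ with hJ | hJ
        · exact other_end_nipv D hadj he hu hv hAE hP (Or.inl rfl) hJ.1
        · exact other_end_nipv D hadj he hu hv hAE hP (Or.inr rfl) hJ.1
      have havoid := b0_avoids D hadj he hu hoff.1 hoff.2
      have hipv : ∀ F, ipv D j (insert s(u, v) A) F ↔ ipv D j A F := by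
        rw [insert_eq_symmDiff hbA]
        exact ipv_symmDiff_iff D h2 hAB havoid
      have hparB : ParityIs D (insert s(u, v) A) (cornersNe D j) := by
        intro F hF
        rw [insert_eq_symmDiff hbA, htoggle A F hF, hP F hF, Finset.mem_union, Finset.mem_insert, Finset.mem_singleton]
        have : (F = x ∨ F = x') → F ∉ cornersNe D j := by rintro (rfl | rfl); exacts [hxCj, hx'Cj]
        exact xor_or_iff' this
      have hpatB : patm D j m (insert s(u, v) A) := by
        rw [insert_eq_symmDiff hbA]
        exact (patm_symmDiff_iff D h2 hAB havoid).2 hpat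
      have hrel : (fun F F' => (sideGraph (hBonds D)).Adj F F' ∧ ¬ ipv D j (insert s(u, v) A) F ∧
            ¬ ipv D j (insert s(u, v) A) F') =
          (fun F F' => (sideGraph (hBonds D)).Adj F F' ∧ ¬ ipv D j A F ∧ ¬ ipv D j A F') := by
        funext F F'
        rw [hipv, hipv]
      refine ⟨insert s(u, v) A, (hmemR _).2 ⟨⟨Finset.insert_subset hbB hAB, hparB⟩, hpatB, ?_⟩, Finset.erase_insert hbA⟩
      unfold JoinedOff
      rw [hrel, hipv x, hipv x', hipv (yc D j)]
      rcases hJ with ⟨h1', h2', h3'⟩ | ⟨h1', h2', h3'⟩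
      · exact Or.inl ⟨h1', h2', hmono _ _ _ h3'⟩
      · exact Or.inr ⟨h1', h2', hmono _ _ _ h3'⟩

end N5

end Literature.Probability.Percolation.FivePoint


/-! ### N3-B1 (a-p4 g6): colourings ↔ loop configurations for the joined-pattern event — `transportColour_holds`

The dictionary between the D1-v2 colouring-side events and the loop-side predicates read in `ξ_{j,c}(σ)`:
`patm ↔ Match_m` (`xiLinked_xiOf_iff` + `isCornerFace_iff_eq_yc`), `ipv ↔ InInterface`, `sideGraph (hBonds D) ↔ HStep`,
hence `JoinedOff (hBonds D) ↔ Joined`; then `card_bij` along `T ↦ ξ_{j,c}(T)` exactly as in `khsLemma2Face_holds`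
(`loopImage/loopInj/loopSurj_holds`, `xiOf_inter`). -/

namespace Literature.Probability.Percolation.FivePoint

namespace N5

open Literature.Probability.Percolation Literature.Probability.LatticeModels FivePoint

variable (D : TriMarkedDomain 5)

/-- B1 dictionary (patterns): the pattern bit read in `ξ_{j,c}(σ)` is the matching of `σ`. [cite: KhristoforovSmirnov2021, §1.2 (loop configurations, pp. 3–4)] -/
theorem b1_patm_xiOf_iff (σ : SiteConfig (Site 2)) (j : Fin 5) (m c : Bool) :
    patm D j m (xiOf D σ j c) ↔ (if m then MatchB D σ j c else MatchA D σ j c) := by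
  unfold patm
  rw [xiLinked_xiOf_iff]
  cases m
  · simp only [Bool.false_eq_true, ↓reduceIte]
    unfold MatchA
    constructor
    · intro h
      exact ⟨yc D (j + 1), yc D (j + 2), yc_spec D _, yc_spec D _, h⟩
    · rintro ⟨Y₁, Y₂, h₁, h₂, h⟩
      rw [eq_yc D h₁, eq_yc D h₂] at h
      exact h
  · simp only [↓reduceIte]
    unfold MatchB
    constructor
    · intro h
      exact ⟨yc D (j + 1), yc D (j + 4), yc_spec D _, yc_spec D _, h⟩
    · rintro ⟨Y₁, Y₂, h₁, h₂, h⟩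
      rw [eq_yc D h₁, eq_yc D h₂] at h
      exact h

/-- B1 dictionary (interfaces): lying on an interface of `ξ_{j,c}(σ)` from a corner `≠ j` is `InInterface`. [cite: KhristoforovSmirnov2021, §1.2 (loop configurations, pp. 3–4)] -/
theorem b1_ipv_xiOf_iff (σ : SiteConfig (Site 2)) (j : Fin 5) (c : Bool) (F : HexVertex) :
    ipv D j (xiOf D σ j c) F ↔ InInterface D σ j c F := by
  unfold ipv InInterface
  constructor
  · rintro ⟨i, hi, hreach⟩
    refine ⟨i, hi, yc D i, yc_spec D i, ?_⟩
    rwa [← xiLinked_xiOf_iff, xiLinked_iff_reachable]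
  · rintro ⟨i, hi, Y, hY, hreach⟩
    refine ⟨i, hi, ?_⟩
    rw [eq_yc D hY] at hreach
    rwa [← xiLinked_iff_reachable, xiLinked_xiOf_iff]

/-- B1 dictionary (steps): the side graph of ALL bonds of `H_G` is the `H_G`-step relation `HStep`. [cite: KhristoforovSmirnov2021, §1.2 (loop configurations, pp. 3–4)] -/
theorem b1_sideGraph_hBonds_adj_iff (F F' : HexVertex) : (sideGraph (hBonds D)).Adj F F' ↔ HStep D F F' := by
  constructor
  · rintro ⟨j, rfl, hj⟩
    refine ⟨hexGraph_adj_oppFace F j, ?_⟩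
    obtain ⟨a, b, he, ha, -⟩ := exists_rep_of_mem_hBonds D hj
    refine ⟨a, ?_, ha⟩
    rw [faceEdge_oppFace, Finset.mem_insert, Finset.mem_singleton]
    unfold side at he
    rcases Sym2.eq_iff.1 he with ⟨h1, -⟩ | ⟨-, h2⟩
    · exact Or.inl h1.symm
    · exact Or.inr h2.symm
  · rintro ⟨hadj, u, hu, huG⟩
    obtain ⟨j, rfl⟩ := exists_oppFace_eq_of_hexGraph_adj hadj
    refine ⟨j, rfl, ?_⟩
    rw [faceEdge_oppFace, Finset.mem_insert, Finset.mem_singleton] at hu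
    have hadj' : triGraph.Adj (faceVertex F (j + 1)) (faceVertex F (j + 2)) := by
      have := TriMarkedDomain.adj_faceVertex_succ F (j + 1)
      rwa [TriMarkedDomain.fin3_add_one_add_one] at this
    unfold side
    refine mem_hBonds D hadj' ?_
    rcases hu with rfl | rfl
    · exact Or.inl huG
    · exact Or.inr huG

/-- B1 dictionary (joining): joined to `y_j` off the interfaces of `ξ_{j,c}(σ)` along `H_G` is `Joined`. [cite: KhristoforovSmirnov2021, §1.2 (loop configurations, pp. 3–4)] -/
theorem b1_joinedOff_xiOf_iff (σ : SiteConfig (Site 2)) (j : Fin 5) (c : Bool) (t : HexVertex) :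
    JoinedOff D (hBonds D) j (xiOf D σ j c) t ↔ Joined D σ j c t := by
  have hipv : ipv D j (xiOf D σ j c) = InInterface D σ j c := by
    funext F; exact propext (b1_ipv_xiOf_iff D σ j c F)
  have hrel : (fun F F' => (sideGraph (hBonds D)).Adj F F' ∧ ¬ ipv D j (xiOf D σ j c) F ∧
      ¬ ipv D j (xiOf D σ j c) F') =
      (fun F F' => HStep D F F' ∧ ¬ InInterface D σ j c F ∧ ¬ InInterface D σ j c F') := by
    funext F F'
    rw [hipv]
    exact propext (and_congr_left' (b1_sideGraph_hBonds_adj_iff D F F'))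
  unfold JoinedOff Joined
  rw [hrel, hipv]
  constructor
  · rintro ⟨ht, hy, hreach⟩
    exact ⟨ht, yc D j, yc_spec D j, hy, hreach⟩
  · rintro ⟨ht, Y, hY, hYI, hreach⟩
    rw [eq_yc D hY] at hYI hreach
    exact ⟨ht, hYI, hreach⟩

/-- B1 dictionary (the whole event). [cite: KhristoforovSmirnov2021, §1.2 (loop configurations, pp. 3–4)] -/
theorem b1_colEvent_iff (σ : SiteConfig (Site 2)) (x x' : HexVertex) (c : Bool) (j : Fin 5) (m : Bool) :
    ((if m then MatchB D σ j c else MatchA D σ j c) ∧ (Joined D σ j c x ∨ Joined D σ j c x')) ↔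
      (patm D j m (xiOf D σ j c) ∧
        (JoinedOff D (hBonds D) j (xiOf D σ j c) x ∨ JoinedOff D (hBonds D) j (xiOf D σ j c) x')) := by
  rw [b1_patm_xiOf_iff, b1_joinedOff_xiOf_iff, b1_joinedOff_xiOf_iff]

/-- **N3-B1: `transportColour_holds`** — `#{T ⊆ G : Match_m ∧ (x or x' joined to y_j)} = #domR`, for every `c`, by
`T ↦ ξ_{j,c}(T)` (`loopImage/loopInj/loopSurj_holds` + the dictionary). [cite: KhristoforovSmirnov2021, §1.2 (loop configurations, pp. 3–4)] -/
theorem transportColour_holds : TransportColour D := by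
  classical
  intro x x' c j m
  refine Finset.card_bij (fun T _ => xiOf D (↑T : Set (Site 2)) j c) (fun T hT => ?_) (fun T hT T' hT' h => ?_)
    (fun ξ hξ => ?_)
  · obtain ⟨-, hev⟩ := Finset.mem_filter.1 hT
    unfold domR
    exact Finset.mem_filter.2 ⟨loopImage_holds D _ j c, (b1_colEvent_iff D _ x x' c j m).1 hev⟩
  · have hTG := Finset.mem_powerset.1 (Finset.mem_filter.1 hT).1
    have hTG' := Finset.mem_powerset.1 (Finset.mem_filter.1 hT').1
    have hag := loopInj_holds D _ _ j c h
    ext u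
    constructor
    · intro hu; exact Finset.mem_coe.1 ((hag u (hTG hu)).1 (Finset.mem_coe.2 hu))
    · intro hu; exact Finset.mem_coe.1 ((hag u (hTG' hu)).2 (Finset.mem_coe.2 hu))
  · unfold domR at hξ
    obtain ⟨hξ, hB⟩ := Finset.mem_filter.1 hξ
    obtain ⟨σ, hσ⟩ := loopSurj_holds D j c ξ hξ
    have hS : (↑(D.verts.filter fun v => v ∈ σ) : Set (Site 2)) = σ ∩ ↑D.verts := by
      ext v; simp [and_comm]
    refine ⟨D.verts.filter (fun v => v ∈ σ),
      Finset.mem_filter.2 ⟨Finset.mem_powerset.2 (Finset.filter_subset _ _), ?_⟩, ?_⟩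
    · rw [hS, b1_colEvent_iff, xiOf_inter, hσ]
      exact hB
    · rw [hS, xiOf_inter, hσ]

end N5

end Literature.Probability.Percolation.FivePoint


/-! # ═══════════════════════ N3 pieces L1–L3 + C (b-step0 gen 9, 2026-08-22) — suffix to b-engine-2's `Loop5Stubs_be2g5.lean` ═══════════════════════

`xorDeg_holds : XorDeg`, `reachXor_holds : ReachXor`, `chainEdgeSet_holds : ChainEdgeSet D`, `transportSplit_holds : TransportSplit D`
(b-engine-2's typed N3 faces, §«N3 TYPED PIECES»), in b-engine-2's vocabulary (`side`, `Inc`, `sideGraph`, `yc`, `patm`, `ParityIs`,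
`codW`, `loopSpace6`, `InClass`). Helper names are prefixed `l1_`, `l2_`, `l3_`, `c_`. -/

noncomputable section

namespace Literature.Probability.Percolation.FivePoint

open Finset Literature.Probability.Percolation Literature.Probability.LatticeModels FivePoint TriMarkedDomain

variable (D : TriMarkedDomain 5)

namespace N5

/-! #### L1: parity of side counts under symmetric difference -/

/-- `xiDeg` counts the sides lying in the edge set. [cite: KhristoforovSmirnov2021, §1.2 (loop configurations, pp. 3–4)] -/
theorem l1_xiDeg_eq (ξ : Finset (Sym2 (Site 2))) (F : HexVertex) :
    xiDeg ξ F = #((Finset.univ : Finset (Fin 3)).filter fun j => side F j ∈ ξ) := rfl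

/-- Cardinality of a XOR-filter: `#{p xor q} + 2 #{p ∧ q} = #{p} + #{q}`. [cite: KhristoforovSmirnov2021, §1.2 (loop configurations, pp. 3–4)] -/
theorem l1_card_filter_xor_add {α : Type*} (s : Finset α) (p q : α → Prop) [DecidablePred p] [DecidablePred q]
    [DecidablePred fun j => Xor (p j) (q j)] [DecidablePred fun j => p j ∧ q j] :
    #(s.filter fun j => Xor (p j) (q j)) + 2 * #(s.filter fun j => p j ∧ q j) = #(s.filter p) + #(s.filter q) := by
  simp only [Finset.card_filter]
  rw [Finset.mul_sum, ← Finset.sum_add_distrib, ← Finset.sum_add_distrib]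
  refine Finset.sum_congr rfl fun j _ => ?_
  by_cases hp : p j <;> by_cases hq : q j <;> simp [hp, hq, Xor]

open Classical in
/-- **L1 `XorDeg`**: the parity of the side count is additive under symmetric difference. [cite: KhristoforovSmirnov2021, §1.2 (loop configurations, pp. 3–4)] -/
theorem xorDeg_holds : XorDeg := by
  intro A B F
  rw [l1_xiDeg_eq, l1_xiDeg_eq, l1_xiDeg_eq]
  have hx : ((Finset.univ : Finset (Fin 3)).filter fun j => side F j ∈ symmDiff A B) =
      (Finset.univ : Finset (Fin 3)).filter fun j => Xor (side F j ∈ A) (side F j ∈ B) :=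
    Finset.filter_congr fun j _ => by rw [Finset.mem_symmDiff]; rfl
  rw [hx]
  have key := l1_card_filter_xor_add (Finset.univ : Finset (Fin 3)) (fun j => side F j ∈ A) (fun j => side F j ∈ B)
  simp only [Nat.odd_iff] at *
  omega

/-- the `{b}`-side-count of a face is odd iff `b` is one of its sides. [cite: KhristoforovSmirnov2021, §1.2 (loop configurations, pp. 3–4)] -/
theorem l1_odd_xiDeg_singleton_iff (b : Sym2 (Site 2)) (F : HexVertex) :
    Odd (xiDeg {b} F) ↔ ∃ i : Fin 3, side F i = b := by
  classical
  rw [l1_xiDeg_eq]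
  by_cases h : ∃ i : Fin 3, side F i = b
  · obtain ⟨i, hi⟩ := h
    have hf : ((Finset.univ : Finset (Fin 3)).filter fun j => side F j ∈ ({b} : Finset (Sym2 (Site 2)))) = {i} := by
      ext j
      simp only [Finset.mem_filter, Finset.mem_univ, true_and, Finset.mem_singleton]
      constructor
      · intro hj; exact side_injective F (hj.trans hi.symm)
      · rintro rfl; exact hi
    rw [hf, Finset.card_singleton]
    exact ⟨fun _ => ⟨i, hi⟩, fun _ => odd_one⟩
  · have hf : ((Finset.univ : Finset (Fin 3)).filter fun j => side F j ∈ ({b} : Finset (Sym2 (Site 2)))) = ∅ := by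
      rw [Finset.filter_eq_empty_iff]
      intro j _ hj
      rw [Finset.mem_singleton] at hj
      exact h ⟨j, hj⟩
    rw [hf, Finset.card_empty]
    exact ⟨fun ho => absurd ho (by decide), fun he => absurd he h⟩

/-! #### L2: XOR off the reachable faces does not change reachability -/

/-- a step of the side graph of `A ∆ γ` out of a face none of whose sides lies in `γ` is a step of the side graph of `A`. [cite: KhristoforovSmirnov2021, §1.2 (loop configurations, pp. 3–4)] -/
theorem l2_adj_symmDiff_iff {A γ : Finset (Sym2 (Site 2))} {W : HexVertex} (hW : ∀ i : Fin 3, side W i ∉ γ) (W' : HexVertex) :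
    (sideGraph (symmDiff A γ)).Adj W W' ↔ (sideGraph A).Adj W W' := by
  show (∃ j : Fin 3, W' = oppFace W j ∧ side W j ∈ symmDiff A γ) ↔ (∃ j : Fin 3, W' = oppFace W j ∧ side W j ∈ A)
  refine exists_congr fun j => and_congr_right fun _ => ?_
  rw [Finset.mem_symmDiff]
  have := hW j
  tauto

/-- **L2 `ReachXor`**: XOR with an edge set incident to no face reachable from `Y` does not change reachability from `Y`.
[cite: KhristoforovSmirnov2021, §1.2 (loop configurations, pp. 3–4)] -/
theorem reachXor_holds : ReachXor := by
  intro A γ Y hγ F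
  have hW : ∀ W, (sideGraph A).Reachable Y W → ∀ i : Fin 3, side W i ∉ γ :=
    fun W hW i hi => hγ _ hi W hW (inc_side W i)
  constructor
  · intro h
    rw [SimpleGraph.reachable_iff_reflTransGen] at h ⊢
    induction h with
    | refl => exact Relation.ReflTransGen.refl
    | tail _ hst ih =>
      have hreach : (sideGraph A).Reachable Y _ := (SimpleGraph.reachable_iff_reflTransGen _ _).2 ih
      exact ih.tail ((l2_adj_symmDiff_iff (hW _ hreach) _).1 hst)
  · intro h
    rw [SimpleGraph.reachable_iff_reflTransGen] at h ⊢
    induction h with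
    | refl => exact Relation.ReflTransGen.refl
    | tail h' hst ih =>
      have hreach : (sideGraph A).Reachable Y _ := (SimpleGraph.reachable_iff_reflTransGen _ _).2 h'
      exact ih.tail ((l2_adj_symmDiff_iff (hW _ hreach) _).2 hst)

/-! #### L3: chains are shadowed by edge sets -/

/-- the touching faces incident to the side `side W j` of an `H_G`-bond are `W` and `oppFace W j`. [cite: BollobasRiordan2006, Ch. 7 §7.2.2 pp. 168–171] -/
theorem l3_inc_side_iff {W F : HexVertex} {j : Fin 3} (hb : side W j ∈ hBonds D) (hF : F ∈ triFacesTouching D.verts) :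
    Inc F (side W j) ↔ (F = W ∨ F = oppFace W j) := by
  have hWt : W ∈ triFacesTouching D.verts := mem_touching_of_side_mem D hb
  have hOt : oppFace W j ∈ triFacesTouching D.verts := by
    have hb' : side (oppFace W j) (oppIdx W j) ∈ hBonds D := by rw [side_oppFace_oppIdx]; exact hb
    exact mem_touching_of_side_mem D hb'
  have hne : W ≠ oppFace W j := (hexGraph_adj_oppFace W j).ne
  have iW : Inc W (side W j) := inc_side W j
  have iO : Inc (oppFace W j) (side W j) := by rw [← side_oppFace_oppIdx]; exact inc_side _ _
  constructor
  · intro hi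
    exact eq_or_eq_of_inc_three D hb hWt hOt hF iW iO hi hne
  · rintro (rfl | rfl)
    · exact iW
    · exact iO

/-- a face has `side W j` among its sides iff it is incident to it (for an `H_G`-bond and a touching face). [cite: BollobasRiordan2006, Ch. 7 §7.2.2 pp. 168–171] -/
theorem l3_exists_side_eq_iff {W F : HexVertex} {j : Fin 3} (hb : side W j ∈ hBonds D) (hF : F ∈ triFacesTouching D.verts) :
    (∃ i : Fin 3, side F i = side W j) ↔ (F = W ∨ F = oppFace W j) := by
  rw [← l3_inc_side_iff D hb hF]
  constructor
  · rintro ⟨i, hi⟩; rw [← hi]; exact inc_side F i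
  · intro hi
    obtain ⟨i, hi⟩ := exists_side_eq_of_inc D hb hi
    exact ⟨i, hi.symm⟩

/-- **L3 `ChainEdgeSet`**: a chain of `E`-steps through `P`-faces is shadowed by the XOR `γ ⊆ E` of its crossed bonds, which touches
only `P`-faces and is odd exactly at the two ends. [cite: KhristoforovSmirnov2021, §1.2 (loop configurations, pp. 3–4)] -/
theorem chainEdgeSet_holds : ChainEdgeSet D := by
  classical
  intro E hE P a b h
  induction h with
  | refl =>
    refine ⟨∅, Finset.empty_subset _, fun e he => absurd he (Finset.notMem_empty _), fun F _ => ?_⟩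
    have h0 : xiDeg (∅ : Finset (Sym2 (Site 2))) F = 0 := by
      rw [l1_xiDeg_eq, Finset.card_eq_zero, Finset.filter_eq_empty_iff]
      intro j _ hj; exact absurd hj (Finset.notMem_empty _)
    rw [h0, xor_self]
    exact ⟨fun h => absurd h (by decide), False.elim⟩
  | tail hab hst ih =>
    rename_i W Z
    obtain ⟨γ, hγE, hγP, hγpar⟩ := ih
    obtain ⟨⟨j, rfl, hj⟩, hPW, hPZ⟩ := hst
    have hb : side W j ∈ hBonds D := hE hj
    refine ⟨symmDiff γ {side W j}, ?_, ?_, fun F hF => ?_⟩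
    · intro e he
      rw [Finset.mem_symmDiff] at he
      rcases he with ⟨h1, -⟩ | ⟨h1, -⟩
      · exact hγE h1
      · rw [Finset.mem_singleton] at h1; subst h1; exact hj
    · intro e he F hF hinc
      rw [Finset.mem_symmDiff] at he
      rcases he with ⟨h1, -⟩ | ⟨h1, -⟩
      · exact hγP e h1 F hF hinc
      · rw [Finset.mem_singleton] at h1
        subst h1
        rcases (l3_inc_side_iff D hb hF).1 hinc with rfl | rfl
        · exact hPW
        · exact hPZ
    · rw [xorDeg_holds, hγpar F hF, l1_odd_xiDeg_singleton_iff, l3_exists_side_eq_iff D hb hF]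
      have hne : W ≠ oppFace W j := (hexGraph_adj_oppFace W j).ne
      have hwz : ¬ (F = W ∧ F = oppFace W j) := fun ⟨e1, e2⟩ => hne (e1.symm.trans e2)
      unfold Xor
      tauto

/-! #### C: `codW = W_{j,m}(x) ⊔ W_{j,m}(x')` -/

/-- unpacking an inner edge `{x, x'}` with bond `{u, v}`: `u ≠ v` and both are vertices of `x` and of `x'`. [cite: BollobasRiordan2006, Ch. 7 §7.2.2 pp. 168–171] -/
theorem c_inner_edge_facts {x x' : HexVertex} {u v : Site 2} (hadj : hexGraph.Adj x x') (he : faceEdge x x' = {u, v}) :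
    u ≠ v ∧ (u ∈ hexFaceVertices x ∧ v ∈ hexFaceVertices x) ∧ (u ∈ hexFaceVertices x' ∧ v ∈ hexFaceVertices x') := by
  have h2 := ((hexGraph_adj_iff x x').1 hadj).2
  have hint : hexFaceVertices x ∩ hexFaceVertices x' = {u, v} := he
  rw [hint] at h2
  have huv : u ≠ v := by
    intro e; subst e
    rw [Finset.insert_eq_of_mem (Finset.mem_singleton_self _), Finset.card_singleton] at h2
    exact absurd h2 (by norm_num)
  have hu : u ∈ hexFaceVertices x ∩ hexFaceVertices x' := by rw [hint]; simp
  have hv : v ∈ hexFaceVertices x ∩ hexFaceVertices x' := by rw [hint]; simp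
  rw [Finset.mem_inter] at hu hv
  exact ⟨huv, ⟨hu.1, hv.1⟩, ⟨hu.2, hv.2⟩⟩

/-- the corner clause of `ParityIs … (insert s (corners D))` unfolded. [cite: KhristoforovSmirnov2021, §1.2 (loop configurations, pp. 3–4)] -/
theorem c_mem_insert_corners_iff (s F : HexVertex) :
    F ∈ insert s (corners D) ↔ ((∃ i : Fin 5, IsCornerFace D i F) ∨ F = s) := by
  unfold corners
  rw [Finset.mem_insert, Finset.mem_image, or_comm]
  refine or_congr ?_ Iff.rfl
  constructor
  · rintro ⟨i, -, hi⟩; exact ⟨i, (isCornerFace_iff_eq_yc D).2 hi.symm⟩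
  · rintro ⟨i, hi⟩; exact ⟨i, Finset.mem_univ _, ((isCornerFace_iff_eq_yc D).1 hi).symm⟩

open Classical in
/-- membership in one of the two summands of `codW`, unfolded to `loopSpace6`/`InClass`. [cite: KhristoforovSmirnov2021, §1.2 (loop configurations, pp. 3–4)] -/
theorem c_mem_filter_inClass_iff (u v : Site 2) (j : Fin 5) (m : Bool) (s : HexVertex)
    (A : Finset (Sym2 (Site 2))) :
    A ∈ (loopSpace6 D u v s).filter (fun ξ => InClass D u v s j m ξ) ↔
      A ⊆ (hBonds D).erase s(u, v) ∧ ParityIs D A (insert s (corners D)) ∧ (sideGraph A).Reachable s (yc D j) ∧ patm D j m A := by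
  rw [Finset.mem_filter]
  unfold InClass
  unfold loopSpace6
  rw [Finset.mem_filter, Finset.mem_powerset]
  unfold ParityIs patm
  have hP : (∀ F ∈ triFacesTouching D.verts, (Odd (xiDeg A F) ↔ (∃ j : Fin 5, IsCornerFace D j F) ∨ F = s)) ↔
      (∀ F ∈ triFacesTouching D.verts, (Odd (xiDeg A F) ↔ F ∈ insert s (corners D))) := by
    refine forall₂_congr fun F _ => ?_
    rw [c_mem_insert_corners_iff]
  have hR : (∃ Y : HexVertex, IsCornerFace D j Y ∧ XiLinked A s Y) ↔ (sideGraph A).Reachable s (yc D j) := by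
    rw [← xiLinked_iff_reachable]
    constructor
    · rintro ⟨Y, hY, hl⟩; rwa [← eq_yc D hY]
    · intro hl; exact ⟨yc D j, yc_spec D j, hl⟩
  have hM : (∃ Y₁ Y₂ : HexVertex, IsCornerFace D (j + 1) Y₁ ∧ IsCornerFace D (if m then j + 4 else j + 2) Y₂ ∧ XiLinked A Y₁ Y₂) ↔
      XiLinked A (yc D (j + 1)) (yc D (if m then j + 4 else j + 2)) := by
    constructor
    · rintro ⟨Y₁, Y₂, h1, h2, hl⟩; rwa [← eq_yc D h1, ← eq_yc D h2]
    · intro hl; exact ⟨_, _, yc_spec D _, yc_spec D _, hl⟩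
  rw [hP, hR, hM]
  tauto

open Classical in
/-- **C `TransportSplit`**: `codW` is the disjoint union of the two class summands `W_{j,m}(x)` and `W_{j,m}(x')`. [cite: KhristoforovSmirnov2021, §1.2 (loop configurations, pp. 3–4)] -/
theorem transportSplit_holds : TransportSplit D := by
  intro x x' u v hx hadj he hu hv j m
  obtain ⟨huv, ⟨hux, hvx⟩, -⟩ := c_inner_edge_facts hadj he
  have hxt : x ∈ triFacesTouching D.verts := mem_triFacesTouching.2 ⟨u, hu, hux⟩
  have key : codW D x x' u v j m =
      (loopSpace6 D u v x).filter (fun ξ => InClass D u v x j m ξ) ∪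
        (loopSpace6 D u v x').filter (fun ξ => InClass D u v x' j m ξ) := by
    ext A
    rw [Finset.mem_union, c_mem_filter_inClass_iff, c_mem_filter_inClass_iff]
    unfold codW
    rw [Finset.mem_filter, Finset.mem_powerset]
    constructor
    · rintro ⟨hsub, s, hs, hpar, hreach, hpat⟩
      rw [Finset.mem_insert, Finset.mem_singleton] at hs
      rcases hs with rfl | rfl
      · exact Or.inl ⟨hsub, hpar, hreach, hpat⟩
      · exact Or.inr ⟨hsub, hpar, hreach, hpat⟩
    · rintro (⟨hsub, hpar, hreach, hpat⟩ | ⟨hsub, hpar, hreach, hpat⟩)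
      · exact ⟨hsub, x, Finset.mem_insert_self _ _, hpar, hreach, hpat⟩
      · exact ⟨hsub, x', Finset.mem_insert_of_mem (Finset.mem_singleton_self _), hpar, hreach, hpat⟩
  have hdisj : Disjoint ((loopSpace6 D u v x).filter (fun ξ => InClass D u v x j m ξ))
      ((loopSpace6 D u v x').filter (fun ξ => InClass D u v x' j m ξ)) := by
    rw [Finset.disjoint_left]
    intro A hA hA'
    rw [c_mem_filter_inClass_iff] at hA hA'
    have h1 : Odd (xiDeg A x) := (hA.2.1 x hxt).2 (Finset.mem_insert_self _ _)
    have h2 := (hA'.2.1 x hxt).1 h1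
    rw [c_mem_insert_corners_iff] at h2
    rcases h2 with ⟨i, hi⟩ | hxx
    · exact not_corner_of_two_mem D hux hvx hu hv huv i hi
    · exact hadj.ne hxx
  rw [key, Finset.card_union_of_disjoint hdisj]

end N5

end Literature.Probability.Percolation.FivePoint

end

/-! # ═══════════════════════ (N) ∀ D — FINAL ASSEMBLY (b-engine-2 g5) ═══════════════════════

All four N3 faces are theorems (B1 a-p4 g6; L1–L3 + C b-step0 g9; A + B2 b-engine-2 g5), hence `SixTransport D`, hence with N1, N2
and `fivePointNormalisation_of_faces`: **(N) `Σ_r midEdgeProb D r c x x' = 1` for EVERY five-marked domain**. -/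

namespace Literature.Probability.Percolation.FivePoint

namespace N5

open Literature.Probability.Percolation Literature.Probability.LatticeModels FivePoint

variable (D : TriMarkedDomain 5)

/-- **N3-A holds**: `#domD = #codW` (the involution; L1–L3 by b-step0 g9). [cite: KhristoforovSmirnov2021, §1.2 (loop configurations, pp. 3–4)] -/
theorem transportCore_holds : TransportCore D := transportCore_of D xorDeg_holds reachXor_holds (chainEdgeSet_holds D)

/-- **N3-B2 holds**: `#domR = #domD`. [cite: KhristoforovSmirnov2021, §1.2 (loop configurations, pp. 3–4)] -/
theorem transportErase_holds : TransportErase D := transportErase_of D xorDeg_holds reachXor_holds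

/-- **N3 holds for every domain**: the K5′ transport `#W_{j,m}(x) + #W_{j,m}(x') = #{T ⊆ G : Match_m ∧ (x or x' joined to y_j)}`. [cite: KhristoforovSmirnov2021, §1.2 (loop configurations, pp. 3–4)] -/
theorem sixTransport_holds : SixTransport D :=
  sixTransport_of_faces D (transportColour_holds D) (transportErase_holds D) (transportCore_holds D) (transportSplit_holds D)

/-- **(N) holds on `D`**: `Σ_{r : Fin 5} midEdgeProb D r c x x' = 1` for every colour `c` and every inner edge `{x, x'}`. [cite: KhristoforovSmirnov2021, §1.2 (loop configurations, pp. 3–4)] -/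
theorem fivePointNormalisationD_holds : FivePointNormalisationD D :=
  fivePointNormalisation_of_faces D (sixCount_holds D) (sixStructure_holds D) (sixTransport_holds D)

/-- **(N) FIVE-POINT NORMALISATION for every five-marked discrete domain, every colour and every inner edge** (the lane's
statement (N) of `FiveMarkedLoops.lean` Part 1, spelled out): `Σ_{r : Fin 5} midEdgeProb D r c x x' = 1`.
[cite: KhristoforovSmirnov2021, §1.2 Lemma 2 and Def. 3 (loop representation; transport of a disorder), pp. 3–5] -/
theorem hexFivePointNormalisation_holds (D : TriMarkedDomain 5) (c : Bool) (x x' : HexVertex)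
    (hx : hexFaceVertices x ⊆ D.verts) (hadj : hexGraph.Adj x x') (he : faceEdge x x' ⊆ D.verts) :
    ∑ r : Fin 5, midEdgeProb D r c x x' = 1 :=
  fivePointNormalisationD_holds D c x x' hx hadj he

end N5

end Literature.Probability.Percolation.FivePoint

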